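import Mathlib
import Literature.NumberTheory.NumberFields.PureCubicClassNumberModThreeProofs
import Literature.NumberTheory.GaloisRepresentations.CyclicNormIndex
import HarnessLib

/-!
# Chevalley's ambiguous classes for the cyclic cubic `K(ζ₃)/ℚ(ζ₃)` of a cubic field `K ∋ ∛m`: `3 ∤ h` criterion, invariant ideals, and the descent `3 ∣ h(K(ζ₃)) ⟹ 3 ∣ h(K)` (Honda 1971; re-homed proofs)

**Chevalley's ambiguous-class machinery for a cyclic cubic extension `L/F` of number fields, specialised to
`L = K(ζ₃) ⊇ F = ℚ(ζ₃)` for a cubic field `K ∋ ∛m`, and the DESCENT `3 ∣ h(K(ζ₃)) ⟹ 3 ∣ h(K)`** — the algebraic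
layer of Honda's criterion for `3 ∣ h(ℚ(∛(pq)))` (T. Honda, J. Number Theory 3 (1971), Theorem; S. Aouissi, D. C. Mayer,
M. C. Ismaili, M. Talbi, A. Azizi, Period. Math. Hungar. 81 (2020), §2.1 (Galois cohomology of the unit group `E_k` of
`k = ℚ(∛d, ζ₃)` over `k₀ = ℚ(ζ₃)`, ambiguous ideals and ambiguous principal ideals, `#H¹(G, E_k) = #H⁰(G, E_k)·[k:k₀]`) and
Thm. 2.3 (`3 ∤ #C_{k,3}^{(σ)} ⟺ 3 ∤ h_k ⟺ 3 ∤ h_L`)).  RE-HOMED into `Literature/` by the Hodge foundations lane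
(`lit-hodgefound`, seat p20, generation 37): verbatim DECLARATION-LEVEL ports, in dependency order and each with its original
module docstring, of the theorem-only modules `Summits/QuantumAdvantage/QuantumAdvantage/Theorems/
LinnikCubicClassGroupsPureCubicClassNumberHard{StubFieldSetup, StubClassNumberNotDvd, DescentGalois, RelNormQuadratic,
StubInvariantIdealsPrincipal, DescentLemmas, Descent}.lean` (route cell `LinnikCubicClassGroups`, where they certified classical
algebraic number theory independent of that route's hypothesis-type crux), namespace
`Summit.QuantumAdvantage.QuantumAdvantage.Theorems.LinnikCubicClassGroups` re-rooted as `Literature.NumberTheory.NumberFields.Honda1971`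
(the namespace of the sibling proof file `PureCubicClassNumberModThreeProofs.lean`, whose installments 1–9 these parts continue;
the six `stub_…` theorems of the source are renamed without the prefix).

CONTENT (Part headers carry the details): (1) the field set-up `L = K(ζ₃) ⊇ F = ℚ(ζ₃)` for `K ∋ ∛(pq)`, `p ≡ 2`, `q ≡ 5 (mod 9)`
(`[L:K] = 2`, `L/F` cyclic cubic, `𝓞_F` a PID with units `±ζ₃ⁱ`, the totally ramified primes above `p, q`); (2) Chevalley's
final step `3 ∤ h_L` for a cyclic cubic `L/F` once norm-unit elements have unit norms and invariant ideals are principal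
(cyclic Hilbert 90 from `Literature/NumberTheory/GaloisRepresentations/CyclicNormIndex.lean`, `Equiv.Perm.card_fixedPoints_modEq`);
(3) `Gal(K(ζ₃)/ℚ) ≅ S₃`: `τστ = σ²`; (4) `N_{L/K}(𝔄)𝓞_L = 𝔄·τ𝔄` in a quadratic Galois layer; (5) `σ`-invariant ideals are
principal (ambiguous-ideal count with nine norm-one units); (6) a fixed class of order `3` and Chevalley's step one class at a
time; (7) the descent `3 ∣ h(K(ζ₃)) ⟹ 3 ∣ h(K)` WITHOUT Hasse's norm theorem and without the Brauer–Kuroda class number relation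
`h(K(ζ₃)) = h(K)²·Q/3` (which is how the printed sources argue) — a deviation of method, not of statement.
Theorem-only file: no definition, no named fact (D-0026); imports Mathlib/Literature only; every declaration carries the citation
of the printed step it formalises or serves.  Consumed by `PureCubicClassNumberModThreeHonda.lean` (same directory), which
completes the proof of the named fact `Honda1971_three_dvd_classNumber_twoPrimes`.  The Summits originals stay in place
(transitional duplication; twins = same short names in `Summit.QuantumAdvantage.QuantumAdvantage.Theorems.LinnikCubicClassGroups`).
-/

noncomputable section

/-!
## Part 1 — port of `Summits/QuantumAdvantage/QuantumAdvantage/Theorems/LinnikCubicClassGroupsPureCubicClassNumberHardStubFieldSetup.lean`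

# Field set-up for the ambiguous-class argument: `L = K(ζ₃) ⊇ F = ℚ(ζ₃)`

For primes `p ≡ 2`, `q ≡ 5 (mod 9)` and a cubic number field `K ∋ α`, `α³ = pq`: the sextic
field `L = K(ζ₃)` (a `{3}`-cyclotomic extension of `K`), its subfield `F = ℚ(ζ₃)`, and the
arithmetic consumed by Chevalley's ambiguous-class argument — `[L:K] = 2`, `[L:ℚ] = 6`, `L/F`
cyclic cubic, `𝓞_F` a PID with units `±ζ₃^i`, `F` totally complex, `θ = α ∈ L`, and the primes
`P₁ ∋ p`, `P₂ ∋ q` of `L`, totally ramified over the inert primes `p𝓞_F`, `q𝓞_F`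
(`p𝓞_L = P₁³`, `q𝓞_L = P₂³`, `e(P₁ | p𝓞_F) = 3`, `#𝓞_F/(p) = p²`).
-/

section Part1

open _root_.Polynomial _root_.NumberField

open scoped _root_.Pointwise _root_.NumberField _root_.IntermediateField

namespace Literature.NumberTheory.NumberFields.Honda1971

/-- Over a cubic number field the third cyclotomic polynomial `X² + X + 1` is irreducible:
a primitive cube root of unity would generate a quadratic subfield, and `2 ∤ 3`. [cite: AouissiMayerIsmailiTalbiAzizi2020, §2.1–2.2 with eq. (2.1) (the Kummer extension k = L(ζ₃) ⊃ k₀ = ℚ(ζ₃), conductor f = pq; field set-up)] -/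
theorem irreducible_cyclotomic_three_of_finrank_eq_three {K : Type*} [Field K] [NumberField K]
    (hK : Module.finrank ℚ K = 3) : Irreducible (cyclotomic 3 K) := by
  have hdeg : (cyclotomic 3 K).natDegree = 2 := by
    rw [natDegree_cyclotomic, Nat.totient_prime Nat.prime_three]
  rw [irreducible_iff_roots_eq_zero_of_degree_le_three (by omega) (by omega),
    Multiset.eq_zero_iff_forall_notMem]
  intro ω hω
  rw [mem_roots (cyclotomic_ne_zero 3 K), isRoot_cyclotomic_iff] at hω
  have hint : IsIntegral ℚ ω := .of_finite ℚ ω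
  have h2 : Module.finrank ℚ ℚ⟮ω⟯ = 2 := by
    rw [IntermediateField.adjoin.finrank hint, ← cyclotomic_eq_minpoly_rat hω (by norm_num),
      natDegree_cyclotomic, Nat.totient_prime Nat.prime_three]
  have htower := Module.finrank_mul_finrank ℚ ℚ⟮ω⟯ K
  rw [h2, hK] at htower
  omega

/-- **`K(ζ₃)` is Galois over `ℚ` for `K = ℚ(∛(pq))`**: it is the splitting field over `ℚ` of
`(X³ − pq)(X³ − 1)` (the roots `ζ₃^i ∛(pq)`, `ζ₃^i` all lie in `K(ζ₃)`, and `∛(pq)`, `ζ₃`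
generate it). [cite: AouissiMayerIsmailiTalbiAzizi2020, §2.1–2.2 with eq. (2.1) (the Kummer extension k = L(ζ₃) ⊃ k₀ = ℚ(ζ₃), conductor f = pq; field set-up)] -/
theorem isGalois_rat_of_isCyclotomicExtension_three {p q : ℕ} (hp : p.Prime) (hq : q.Prime)
    (hpq : p ≠ q) {K : Type*} [Field K] [NumberField K] (hK : Module.finrank ℚ K = 3) {α : K}
    (hα : α ^ 3 = ((p * q : ℕ) : K)) (L : Type*) [Field L] [NumberField L] [Algebra K L]
    [IsCyclotomicExtension {3} K L] : IsGalois ℚ L := by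
  obtain ⟨ζ, hζ⟩ : ∃ ζ : L, IsPrimitiveRoot ζ 3 := ⟨_, IsCyclotomicExtension.zeta_spec 3 K L⟩
  obtain ⟨θ, hθdef⟩ : ∃ θ : L, θ = algebraMap K L α := ⟨_, rfl⟩
  have hθ : θ ^ 3 = ((p * q : ℕ) : L) := by rw [hθdef, ← map_pow, hα, map_natCast]
  obtain ⟨f, hfdef⟩ : ∃ f : ℚ[X], f = (X ^ 3 - C ((p * q : ℕ) : ℚ)) * (X ^ 3 - C 1) := ⟨_, rfl⟩
  have hfmonic : f.Monic :=
    hfdef ▸ (monic_X_pow_sub_C _ three_ne_zero).mul (monic_X_pow_sub_C _ three_ne_zero)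
  have hsplit : (f.map (algebraMap ℚ L)).Splits := by
    rw [hfdef, Polynomial.map_mul]
    refine Splits.mul ?_ ?_
    · have h1 : (X ^ 3 - C ((p * q : ℕ) : ℚ)).map (algebraMap ℚ L) =
          X ^ 3 - C ((p * q : ℕ) : L) := by
        simp [Polynomial.map_sub, Polynomial.map_pow]
      rw [h1]
      exact X_pow_sub_C_splits_of_isPrimitiveRoot hζ hθ
    · have h1 : (X ^ 3 - C (1 : ℚ)).map (algebraMap ℚ L) = X ^ 3 - C (1 : L) := by
        simp [Polynomial.map_sub, Polynomial.map_pow]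
      rw [h1]
      exact X_pow_sub_C_splits_of_isPrimitiveRoot hζ (one_pow 3)
  have hθroot : θ ∈ f.rootSet L := hfmonic.mem_rootSet.mpr (by simp [hfdef, hθ])
  have hζroot : ζ ∈ f.rootSet L := hfmonic.mem_rootSet.mpr (by simp [hfdef, hζ.pow_eq_one])
  have htop : IntermediateField.adjoin ℚ (f.rootSet L) = ⊤ := by
    have hθE : θ ∈ IntermediateField.adjoin ℚ (f.rootSet L) :=
      IntermediateField.subset_adjoin ℚ _ hθroot
    have hζE : ζ ∈ IntermediateField.adjoin ℚ (f.rootSet L) :=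
      IntermediateField.subset_adjoin ℚ _ hζroot
    -- the image of `K = ℚ(α)` lies in `ℚ(roots)`
    have hKE : ∀ k : K, algebraMap K L k ∈ IntermediateField.adjoin ℚ (f.rootSet L) := by
      intro k
      have hk : k ∈ IntermediateField.adjoin ℚ {α} := by
        rw [Literature.NumberTheory.NumberFields.Honda1971.adjoin_eq_top hp hq hpq hK hα]
        exact IntermediateField.mem_top
      have hk' : algebraMap K L k ∈
          (IntermediateField.adjoin ℚ {α}).map (IsScalarTower.toAlgHom ℚ K L) :=
        (IntermediateField.mem_map _).mpr ⟨k, hk, rfl⟩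
      rw [IntermediateField.adjoin_map, Set.image_singleton, IsScalarTower.coe_toAlgHom',
        ← hθdef] at hk'
      exact IntermediateField.adjoin_le_iff.mpr (Set.singleton_subset_iff.mpr hθE) hk'
    -- and `L = K(ζ)`
    rw [eq_top_iff]
    rintro x -
    have hx : x ∈ Algebra.adjoin K ({ζ} : Set L) := by
      rw [IsCyclotomicExtension.adjoin_primitive_root_eq_top hζ]
      exact Algebra.mem_top
    induction hx using Algebra.adjoin_induction with
    | mem x hx =>
      rw [Set.mem_singleton_iff] at hx
      rw [hx]
      exact hζE
    | algebraMap r => exact hKE r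
    | add x y _ _ hx hy => exact add_mem hx hy
    | mul x y _ _ hx hy => exact mul_mem hx hy
  haveI : f.IsSplittingField ℚ L := isSplittingField_iff_intermediateField.mpr ⟨hsplit, htop⟩
  haveI : Normal ℚ L := Normal.of_isSplittingField f
  exact { to_isSeparable := inferInstance, to_normal := inferInstance }

/-- **The units of `ℚ(ζ₃)` are `±ζ₃^i`** (Mathlib's `IsCyclotomicExtension.Rat.Three.Units.mem`,
repackaged). [cite: AouissiMayerIsmailiTalbiAzizi2020, §2.1–2.2 with eq. (2.1) (the Kummer extension k = L(ζ₃) ⊃ k₀ = ℚ(ζ₃), conductor f = pq; field set-up)] -/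
theorem exists_units_eq_pow_or_neg_pow {F : Type*} [Field F] [NumberField F]
    [IsCyclotomicExtension {3} ℚ F] {ζ : F} (hζ : IsPrimitiveRoot ζ 3) :
    ∃ η : (𝓞 F)ˣ, ((η : 𝓞 F) : F) = ζ ∧ ∀ w : (𝓞 F)ˣ, ∃ i : ℕ, w = η ^ i ∨ w = -η ^ i := by
  refine ⟨(IsPrimitiveRoot.isUnit hζ.toInteger_isPrimitiveRoot (by decide)).unit, rfl,
    fun w => ?_⟩
  have hw := IsCyclotomicExtension.Rat.Three.Units.mem hζ w
  simp only [List.mem_cons, List.not_mem_nil, or_false] at hw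
  rcases hw with h | h | h | h | h | h <;> subst h
  · exact ⟨0, Or.inl (pow_zero _).symm⟩
  · exact ⟨0, Or.inr (by rw [pow_zero])⟩
  · exact ⟨1, Or.inl (pow_one _).symm⟩
  · exact ⟨1, Or.inr (by rw [pow_one])⟩
  · exact ⟨2, Or.inl rfl⟩
  · exact ⟨2, Or.inr rfl⟩

/-- **Total ramification of `p` in `L = K(ζ₃)`.**  Let `K ∋ α` be cubic with `α³ = pq`
(`p ≠ q` primes, `p ≡ 2 (mod 3)`), `L ⊇ K` a sextic number field and `F ⊆ L` a copy of
`ℚ(ζ₃)`.  Then there is a maximal ideal `P ∋ p` of `𝓞 L` with `p𝓞_L = P³`,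
`e(P | P ∩ 𝓞_F) = 3`, `3 ∉ P ∩ 𝓞_F` and `#(𝓞_F / P ∩ 𝓞_F) = p²`.  (Fundamental identity
`∑ e f = 6` over the primes above `p`: `3 ∣ e` through `K` — `p` is totally ramified in `K` —
and `2 ∣ f` through `F` — `p ≡ 2 (mod 3)` is inert in `ℚ(ζ₃)` — so there is a single prime,
with `e = 3`, `f = 2`.) [cite: AouissiMayerIsmailiTalbiAzizi2020, §2.1–2.2 with eq. (2.1) (the Kummer extension k = L(ζ₃) ⊃ k₀ = ℚ(ζ₃), conductor f = pq; field set-up)] -/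
theorem exists_prime_pow_three_eq_span {K L : Type*} [Field K] [NumberField K] [Field L]
    [NumberField L] [Algebra K L] (F : IntermediateField ℚ L) [IsCyclotomicExtension {3} ℚ F]
    (hL6 : Module.finrank ℚ L = 6) {p q : ℕ} (hp : p.Prime) (hq : q.Prime) (hpq : p ≠ q)
    (hp3 : p % 3 = 2) (hK : Module.finrank ℚ K = 3) {α : K} (hα : α ^ 3 = ((p * q : ℕ) : K)) :
    ∃ P : Ideal (𝓞 L), P.IsMaximal ∧ (p : 𝓞 L) ∈ P ∧ Ideal.span {(p : 𝓞 L)} = P ^ 3 ∧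
      P.ramificationIdx (𝓞 F) = 3 ∧ (3 : 𝓞 F) ∉ P.under (𝓞 F) ∧
      Nat.card ((𝓞 F) ⧸ P.under (𝓞 F)) = p ^ 2 := by
  haveI : Fact p.Prime := ⟨hp⟩
  -- the prime `pℤ`
  obtain ⟨𝔭, h𝔭def⟩ : ∃ 𝔭 : Ideal ℤ, 𝔭 = Ideal.span {(p : ℤ)} := ⟨_, rfl⟩
  haveI h𝔭max : 𝔭.IsMaximal := h𝔭def ▸
    Ideal.IsPrime.isMaximal
      ((Ideal.span_singleton_prime (by exact_mod_cast hp.ne_zero)).mpr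
        (Nat.prime_iff_prime_int.mp hp)) (by simpa using hp.ne_zero)
  have h𝔭0 : 𝔭 ≠ ⊥ := by
    rw [h𝔭def, Ne, Ideal.span_singleton_eq_bot]
    exact_mod_cast hp.ne_zero
  -- `p ∈ Q` for every prime `Q` above `pℤ`
  have hmem : ∀ (Q : Ideal (𝓞 L)) [Q.LiesOver 𝔭], (p : 𝓞 L) ∈ Q := by
    intro Q _
    have h1 : ((p : ℕ) : ℤ) ∈ Q.under ℤ := by
      rw [← Ideal.over_def Q 𝔭, h𝔭def]
      exact Ideal.mem_span_singleton_self _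
    rw [Ideal.under_def, Ideal.mem_comap, map_natCast] at h1
    exact h1
  -- `e(Q | p) = 3 · e(Q | 𝓞 K)`: `p` is totally ramified in `K`
  have he : ∀ (Q : Ideal (𝓞 L)) [Q.IsMaximal] [Q.LiesOver 𝔭],
      Q.ramificationIdx ℤ = 3 * Q.ramificationIdx (𝓞 K) := by
    intro Q _ _
    haveI : (Q.under (𝓞 K)).IsMaximal := Ideal.IsMaximal.under _ Q
    have hne : Q.under (𝓞 K) ≠ ⊥ := Ideal.IsMaximal.ne_bot_of_isIntegral_int _
    let v : IsDedekindDomain.HeightOneSpectrum (𝓞 K) :=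
      ⟨Q.under (𝓞 K), Ideal.IsMaximal.isPrime inferInstance, hne⟩
    have hpv : (p : 𝓞 K) ∈ v.asIdeal := by
      change (p : 𝓞 K) ∈ Q.under (𝓞 K)
      rw [Ideal.under_def, Ideal.mem_comap, map_natCast]
      exact hmem Q
    have h3 : (Q.under (𝓞 K)).ramificationIdx ℤ = 3 :=
      Literature.NumberTheory.NumberFields.Honda1971.ramificationIdx_eq_three hp hq hpq hK hα v hpv
    rw [Ideal.ramificationIdx_tower (R := ℤ) (Q.under (𝓞 K)) Q, h3]
  -- `f(Q ∩ 𝓞F | p) = 2`: `p ≡ 2 (mod 3)` is inert in `ℚ(ζ₃)`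
  have hp3' : ¬ p ∣ 3 := fun h => by
    have := (Nat.prime_dvd_prime_iff_eq hp Nat.prime_three).mp h
    omega
  have hord : orderOf (p : ZMod 3) = 2 := by
    haveI : Fact (Nat.Prime 2) := ⟨Nat.prime_two⟩
    have hcast : (p : ZMod 3) = 2 := by
      rw [← ZMod.natCast_mod, hp3]
      rfl
    rw [hcast]
    exact orderOf_eq_prime (by decide) (by decide)
  have hfF : ∀ (Q : Ideal (𝓞 L)) [Q.IsMaximal] [Q.LiesOver 𝔭],
      (Q.under (𝓞 F)).inertiaDeg ℤ = 2 := by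
    intro Q _ _
    haveI : (Q.under (𝓞 F)).LiesOver (Ideal.span {(p : ℤ)}) := h𝔭def ▸ inferInstance
    rw [IsCyclotomicExtension.Rat.inertiaDeg_eq_of_not_dvd p F (Q.under (𝓞 F)) hp3', hord]
  have hf : ∀ (Q : Ideal (𝓞 L)) [Q.IsMaximal] [Q.LiesOver 𝔭],
      Q.inertiaDeg ℤ = 2 * Q.inertiaDeg (𝓞 F) := by
    intro Q _ _
    rw [Ideal.inertiaDeg_tower (R := ℤ) (Q.under (𝓞 F)) Q, hfF Q]
  -- every term of the fundamental identity `∑ e f = 6` is `≥ 6`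
  have hge : ∀ Q : 𝔭.primesOver (𝓞 L), 6 ≤ Q.1.ramificationIdx ℤ * Q.1.inertiaDeg ℤ := by
    rintro ⟨Q, hQp, hQl⟩
    haveI : Q.IsMaximal := Ideal.IsMaximal.of_liesOver_isMaximal Q 𝔭
    have h1 := he Q
    have h2 := hf Q
    have h3 : 0 < Q.ramificationIdx (𝓞 K) := Ideal.ramificationIdx_pos _ _
    have h4 : 0 < Q.inertiaDeg (𝓞 F) := Ideal.inertiaDeg_pos _ _
    change 6 ≤ Q.ramificationIdx ℤ * Q.inertiaDeg ℤ
    rw [h1, h2]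
    nlinarith
  -- a prime `P` above `pℤ`; it is the only one, and `e(P|p) f(P|p) = 6`
  obtain ⟨P, hPmax, hPover⟩ := Ideal.exists_maximal_ideal_liesOver_of_isIntegral (S := 𝓞 L) 𝔭
  have hsum := Ideal.sum_ramification_inertia_eq_finrank 𝔭 (𝓞 L)
  rw [RingOfIntegers.rank, hL6] at hsum
  let P' : 𝔭.primesOver (𝓞 L) := ⟨P, hPmax.isPrime, hPover⟩
  have huniq : ∀ Q : 𝔭.primesOver (𝓞 L), Q = P' := by
    intro Q
    by_contra hne
    have h2 : ∑ x ∈ ({Q, P'} : Finset (𝔭.primesOver (𝓞 L))),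
        x.1.ramificationIdx ℤ * x.1.inertiaDeg ℤ ≤ 6 := by
      rw [← hsum]
      exact Finset.sum_le_sum_of_subset (Finset.subset_univ _)
    rw [Finset.sum_pair hne] at h2
    have := hge Q
    have := hge P'
    omega
  have hPef : P.ramificationIdx ℤ * P.inertiaDeg ℤ = 6 := by
    rw [← hsum]
    haveI : Subsingleton (𝔭.primesOver (𝓞 L)) := ⟨fun a b => (huniq a).trans (huniq b).symm⟩
    exact (Fintype.sum_subsingleton
      (fun x : 𝔭.primesOver (𝓞 L) => x.1.ramificationIdx ℤ * x.1.inertiaDeg ℤ) P').symm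
  have heP : P.ramificationIdx ℤ = 3 := by
    have h1 := he P
    have h2 := hf P
    have h3 : 0 < P.ramificationIdx (𝓞 K) := Ideal.ramificationIdx_pos _ _
    have h4 : 0 < P.inertiaDeg (𝓞 F) := Ideal.inertiaDeg_pos _ _
    rw [h1, h2] at hPef
    have h5 : P.ramificationIdx (𝓞 K) ≤ 1 := by nlinarith
    rw [h1]
    omega
  refine ⟨P, hPmax, hmem P, ?_, ?_, ?_, ?_⟩
  · -- `p𝓞_L = P³`: `P` is the only prime factor, with multiplicity `e(P|p) = 3`
    have hI : Ideal.span {(p : 𝓞 L)} = 𝔭.map (algebraMap ℤ (𝓞 L)) := by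
      rw [h𝔭def, Ideal.map_span, Set.image_singleton, map_natCast]
    have hI0 : 𝔭.map (algebraMap ℤ (𝓞 L)) ≠ ⊥ := by
      rw [← hI, Ne, Ideal.span_singleton_eq_bot]
      exact_mod_cast hp.ne_zero
    have hcount := Ideal.IsDedekindDomain.ramificationIdx_eq_normalizedFactors_count 𝔭 P hI0
    have hall : ∀ Q ∈ UniqueFactorizationMonoid.normalizedFactors (𝔭.map (algebraMap ℤ (𝓞 L))),
        Q = P := by
      intro Q hQ
      have hQ' : Q ∈ 𝔭.primesOver (𝓞 L) := by
        rw [← IsDedekindDomain.coe_primesOverFinset h𝔭0 (𝓞 L), Finset.mem_coe,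
          Multiset.mem_toFinset, UniqueFactorizationMonoid.factors_eq_normalizedFactors]
        exact hQ
      exact congrArg Subtype.val (huniq ⟨Q, hQ'⟩)
    have hnf : UniqueFactorizationMonoid.normalizedFactors (𝔭.map (algebraMap ℤ (𝓞 L))) =
        Multiset.replicate 3 P := by
      have h := Multiset.eq_replicate_card.mpr hall
      rw [h, Multiset.count_replicate_self, heP] at hcount
      rw [h, ← hcount]
    rw [hI, ← Ideal.prod_normalizedFactors_eq_self hI0, hnf, Multiset.prod_replicate]
  · -- `e(P | P ∩ 𝓞F) = e(P|p) / e(P ∩ 𝓞F | p) = 3 / 1`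
    have ht := Ideal.ramificationIdx_tower (R := ℤ) (P.under (𝓞 F)) P
    haveI : (P.under (𝓞 F)).LiesOver (Ideal.span {(p : ℤ)}) := h𝔭def ▸ inferInstance
    rw [heP, IsCyclotomicExtension.Rat.ramificationIdx_eq_of_not_dvd p F (P.under (𝓞 F)) hp3',
      one_mul] at ht
    exact ht.symm
  · -- `3 ∉ P ∩ 𝓞F ∋ p`
    intro h3
    haveI : (P.under (𝓞 F)).IsMaximal := Ideal.IsMaximal.under _ P
    have hpF : (p : 𝓞 F) ∈ P.under (𝓞 F) := by
      rw [Ideal.under_def, Ideal.mem_comap, map_natCast]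
      exact hmem P
    have hcop : IsCoprime (p : 𝓞 F) (3 : 𝓞 F) := by
      have h' : IsCoprime (p : ℤ) (3 : ℤ) :=
        Nat.isCoprime_iff_coprime.mpr ((Nat.coprime_primes hp Nat.prime_three).mpr (by omega))
      simpa using h'.map (Int.castRingHom (𝓞 F))
    obtain ⟨a, b, hab⟩ := hcop
    exact (Ideal.IsMaximal.ne_top inferInstance) ((Ideal.eq_top_iff_one _).mpr
      (hab ▸ (P.under (𝓞 F)).add_mem ((P.under (𝓞 F)).mul_mem_left a hpF)
        ((P.under (𝓞 F)).mul_mem_left b h3)))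
  · -- `#(𝓞F / P ∩ 𝓞F) = N(P ∩ 𝓞F) = p^f = p²`
    haveI : (P.under (𝓞 F)).LiesOver (Ideal.span {(p : ℤ)}) := h𝔭def ▸ inferInstance
    rw [← Submodule.cardQuot_apply, ← Ideal.absNorm_apply, ← Ideal.pow_inertiaDeg p (P.under (𝓞 F)),
      hfF P]

/-- **The construction for a given `{3}`-cyclotomic extension `L` of `K`.**  All conjuncts of
`fieldSetup` hold for any `L = K(ζ₃)`. [cite: AouissiMayerIsmailiTalbiAzizi2020, §2.1–2.2 with eq. (2.1) (the Kummer extension k = L(ζ₃) ⊃ k₀ = ℚ(ζ₃), conductor f = pq; field set-up)] -/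
theorem fieldSetup_of_isCyclotomicExtension {p q : ℕ} (hp : p.Prime) (hq : q.Prime)
    (hp9 : p % 9 = 2) (hq9 : q % 9 = 5) (K : Type*) [Field K] [NumberField K]
    (hK : Module.finrank ℚ K = 3) {α : K} (hα : α ^ 3 = ((p * q : ℕ) : K))
    (L : Type*) [Field L] [NumberField L] [Algebra K L] [IsCyclotomicExtension {3} K L] :
    Module.finrank K L = 2 ∧ Module.finrank ℚ L = 6 ∧
      ∃ F : IntermediateField ℚ L,
        IsGalois F L ∧ Module.finrank F L = 3 ∧
        (∃ σ : L ≃ₐ[F] L, ∀ τ : L ≃ₐ[F] L, τ ∈ Subgroup.zpowers σ) ∧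
        IsPrincipalIdealRing (𝓞 F) ∧
        (∀ v : NumberField.InfinitePlace F, v.IsComplex) ∧
        (∃ θ : L, θ ^ 3 = ((p * q : ℕ) : L)) ∧
        ∃ ζ : (𝓞 F)ˣ, ((ζ : 𝓞 F) : F) ^ 3 = 1 ∧ ((ζ : 𝓞 F) : F) ≠ 1 ∧
          (∀ w : (𝓞 F)ˣ, ∃ i : ℕ, w = ζ ^ i ∨ w = -ζ ^ i) ∧
          ∃ P₁ P₂ : Ideal (𝓞 L), P₁.IsMaximal ∧ P₂.IsMaximal ∧ P₁ ≠ P₂ ∧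
            Ideal.span {(p : 𝓞 L)} = P₁ ^ 3 ∧
            Ideal.span {(q : 𝓞 L)} = P₂ ^ 3 ∧
            P₁.ramificationIdx (𝓞 F) = 3 ∧
            (3 : 𝓞 F) ∉ P₁.under (𝓞 F) ∧
            ¬ 9 ∣ Nat.card ((𝓞 F) ⧸ P₁.under (𝓞 F)) - 1 := by
  have hpq : p ≠ q := by
    rintro rfl
    omega
  have hp3 : p % 3 = 2 := by omega
  have hq3 : q % 3 = 2 := by omega
  -- degrees
  have hKL : Module.finrank K L = 2 := by
    rw [IsCyclotomicExtension.finrank L (irreducible_cyclotomic_three_of_finrank_eq_three hK),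
      Nat.totient_prime Nat.prime_three]
  have hL6 : Module.finrank ℚ L = 6 := by
    rw [← Module.finrank_mul_finrank ℚ K L, hK, hKL]
  -- `ζ₃ ∈ L`, `θ = α ∈ L`
  obtain ⟨ζ, hζ⟩ : ∃ ζ : L, IsPrimitiveRoot ζ 3 := ⟨_, IsCyclotomicExtension.zeta_spec 3 K L⟩
  have hθ : ∃ θ : L, θ ^ 3 = ((p * q : ℕ) : L) :=
    ⟨algebraMap K L α, by rw [← map_pow, hα, map_natCast]⟩
  -- `L/ℚ` is Galois
  haveI : IsGalois ℚ L := isGalois_rat_of_isCyclotomicExtension_three hp hq hpq hK hα L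
  -- `F = ℚ(ζ₃)`
  haveI hF : IsCyclotomicExtension {3} ℚ ℚ⟮ζ⟯ :=
    hζ.intermediateField_adjoin_isCyclotomicExtension ℚ
  have hF2 : Module.finrank ℚ ℚ⟮ζ⟯ = 2 := by
    rw [IsCyclotomicExtension.finrank (n := 3) ℚ⟮ζ⟯ (cyclotomic.irreducible_rat (by norm_num)),
      Nat.totient_prime Nat.prime_three]
  have hFL : Module.finrank ℚ⟮ζ⟯ L = 3 := by
    have h := Module.finrank_mul_finrank ℚ ℚ⟮ζ⟯ L
    rw [hF2, hL6] at h
    omega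
  refine ⟨hKL, hL6, ℚ⟮ζ⟯, inferInstance, hFL, ?_, IsCyclotomicExtension.Rat.three_pid ℚ⟮ζ⟯,
    (IsCyclotomicExtension.Rat.isTotallyComplex ℚ⟮ζ⟯ (n := 3) (by norm_num)).isComplex, hθ, ?_⟩
  · -- `Gal(L/F)` has prime order `3`, hence is cyclic
    haveI : Fact (Nat.Prime 3) := ⟨Nat.prime_three⟩
    haveI : IsCyclic (L ≃ₐ[ℚ⟮ζ⟯] L) :=
      isCyclic_of_prime_card (p := 3) (by rw [IsGalois.card_aut_eq_finrank, hFL])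
    exact IsCyclic.exists_generator
  -- units of `F`
  have hζF : IsPrimitiveRoot (⟨ζ, IntermediateField.mem_adjoin_simple_self ℚ ζ⟩ : ℚ⟮ζ⟯) 3 :=
    IsPrimitiveRoot.coe_submonoidClass_iff.mp hζ
  obtain ⟨η, hη, hunits⟩ := exists_units_eq_pow_or_neg_pow hζF
  refine ⟨η, ?_, ?_, hunits, ?_⟩
  · rw [hη]
    exact hζF.pow_eq_one
  · rw [hη]
    exact hζF.ne_one (by norm_num)
  -- the primes above `p` and `q`
  obtain ⟨P₁, hP₁, hpP₁, hspan₁, he₁, h3, hcard⟩ :=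
    exists_prime_pow_three_eq_span ℚ⟮ζ⟯ hL6 hp hq hpq hp3 hK hα
  have hα' : α ^ 3 = ((q * p : ℕ) : K) := by rwa [Nat.mul_comm]
  obtain ⟨P₂, hP₂, hqP₂, hspan₂, -, -, -⟩ :=
    exists_prime_pow_three_eq_span ℚ⟮ζ⟯ hL6 hq hp hpq.symm hq3 hK hα'
  refine ⟨P₁, P₂, hP₁, hP₂, ?_, hspan₁, hspan₂, he₁, h3, ?_⟩
  · -- `P₁ ≠ P₂` since `(p, q) = 1`
    rintro rfl
    have hcop : IsCoprime (p : 𝓞 L) (q : 𝓞 L) := by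
      have h' : IsCoprime (p : ℤ) (q : ℤ) :=
        Nat.isCoprime_iff_coprime.mpr ((Nat.coprime_primes hp hq).mpr hpq)
      simpa using h'.map (Int.castRingHom (𝓞 L))
    obtain ⟨a, b, hab⟩ := hcop
    exact hP₁.ne_top ((Ideal.eq_top_iff_one _).mpr
      (hab ▸ P₁.add_mem (P₁.mul_mem_left a hpP₁) (P₁.mul_mem_left b hqP₂)))
  · -- `#(𝓞F/𝔭) - 1 = p² - 1 ≡ 3 (mod 9)`
    rw [hcard]
    have h1 : p ^ 2 % 9 = 4 := by
      rw [Nat.pow_mod, hp9]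
    omega

/-- **Field set-up for the (2,5)-direction of Honda's criterion.**  For primes `p ≡ 2`,
`q ≡ 5 (mod 9)` and a cubic number field `K ∋ ∛(pq)`: the field `L = K(ζ₃)` (`[L:K] = 2`,
`[L:ℚ] = 6`), its subfield `F = ℚ(ζ₃)` with `L/F` cyclic cubic, `𝓞_F` a PID with units
`±ζ₃^i`, `F` totally complex, `θ = ∛(pq) ∈ L`, and the totally ramified primes `P₁ ∋ p`,
`P₂ ∋ q` of `L` (`p𝓞_L = P₁³`, `q𝓞_L = P₂³`, `e(P₁ | P₁ ∩ 𝓞_F) = 3`, `3 ∉ P₁ ∩ 𝓞_F`,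
`9 ∤ #(𝓞_F/P₁ ∩ 𝓞_F) − 1 = p² − 1`). [cite: AouissiMayerIsmailiTalbiAzizi2020, §2.1–2.2 with eq. (2.1) (the Kummer extension k = L(ζ₃) ⊃ k₀ = ℚ(ζ₃), conductor f = pq; field set-up)] -/
theorem fieldSetup :
    ∀ p q : ℕ, p.Prime → q.Prime → p % 9 = 2 → q % 9 = 5 →
    ∀ (K : Type) [Field K] [NumberField K], Module.finrank ℚ K = 3 →
      (∃ α : K, α ^ 3 = ((p * q : ℕ) : K)) →
      ∃ (L : Type) (_ : Field L) (_ : NumberField L) (_ : Algebra K L),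
        Module.finrank K L = 2 ∧ Module.finrank ℚ L = 6 ∧
        ∃ F : IntermediateField ℚ L,
          IsGalois F L ∧ Module.finrank F L = 3 ∧
          (∃ σ : L ≃ₐ[F] L, ∀ τ : L ≃ₐ[F] L, τ ∈ Subgroup.zpowers σ) ∧
          IsPrincipalIdealRing (𝓞 F) ∧
          (∀ v : NumberField.InfinitePlace F, v.IsComplex) ∧
          (∃ θ : L, θ ^ 3 = ((p * q : ℕ) : L)) ∧
          ∃ ζ : (𝓞 F)ˣ, ((ζ : 𝓞 F) : F) ^ 3 = 1 ∧ ((ζ : 𝓞 F) : F) ≠ 1 ∧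
            (∀ w : (𝓞 F)ˣ, ∃ i : ℕ, w = ζ ^ i ∨ w = -ζ ^ i) ∧
            ∃ P₁ P₂ : Ideal (𝓞 L), P₁.IsMaximal ∧ P₂.IsMaximal ∧ P₁ ≠ P₂ ∧
              Ideal.span {(p : 𝓞 L)} = P₁ ^ 3 ∧
              Ideal.span {(q : 𝓞 L)} = P₂ ^ 3 ∧
              P₁.ramificationIdx (𝓞 F) = 3 ∧
              (3 : 𝓞 F) ∉ P₁.under (𝓞 F) ∧
              ¬ 9 ∣ Nat.card ((𝓞 F) ⧸ P₁.under (𝓞 F)) - 1 := by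
  intro p q hp hq hp9 hq9 K _ _ hK hα
  obtain ⟨α, hα⟩ := hα
  exact ⟨CyclotomicField 3 K, inferInstance, inferInstance, inferInstance,
    fieldSetup_of_isCyclotomicExtension hp hq hp9 hq9 K hK hα (CyclotomicField 3 K)⟩

end Literature.NumberTheory.NumberFields.Honda1971

end Part1

/-!
## Part 2 — port of `Summits/QuantumAdvantage/QuantumAdvantage/Theorems/LinnikCubicClassGroupsPureCubicClassNumberHardStubClassNumberNotDvd.lean`

# Chevalley's ambiguous-class step: `3 ∤ h_L` for a cyclic cubic extension `L/F`

Final step of the ambiguous-class argument (Chevalley 1933; Honda 1971 §2) for a cyclic cubic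
extension `L/F` of number fields with group `⟨σ⟩`: if
(i) every element of `L` whose norm is a unit of `F` has the norm of a UNIT of `L`, and
(ii) every nonzero `σ`-invariant ideal of `𝓞 L` is principal,
then `3 ∤ h_L`.

* `mk0_eq_one_of_mk0_smul_eq` — an invariant ideal CLASS is trivial: from `(x)·σI = (y)·I`
  one gets `N(y/x) ∈ 𝓞_Fˣ`, so by (i) and the cyclic Hilbert 90 of the tree
  (`CyclicNormIndex.exists_eq_div_of_norm_eq_one`) `y/x = ε·σ(w)/w` with `w ∈ 𝓞 L`, and
  `J = (σw)(σ²w)·I` is a `σ`-invariant ideal in the class of `I`, principal by (ii).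
* `classNumber_not_dvd` — `I ↦ σ • I` induces a map `f` of the finite set `Cl(L)`
  (`exists_classMap`) with `f³ = 1` and the single fixed point `1`, so `h_L ≡ 1 (mod 3)`
  (`Equiv.Perm.card_fixedPoints_modEq`).
-/

section Part2

open _root_.NumberField

open scoped _root_.Pointwise _root_.NumberField nonZeroDivisors

namespace Literature.NumberTheory.NumberFields.Honda1971

/-! ### The pointwise action on nonzero ideals and on ideal classes -/

section ClassMap

variable {M R : Type*} [Group M] [CommRing R] [MulSemiringAction M R]

/-- `σ • (x) = (σ x)` for the pointwise action of ring automorphisms on ideals. [cite: AouissiMayerIsmailiTalbiAzizi2020, §2.1 and proof of Thm. 2.3 (ambiguous classes of k/k₀: 3 ∤ #C^{(σ)} ⟹ 3 ∤ h_k; Chevalley's step)] -/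
theorem pointwise_smul_span_singleton (a : M) (x : R) :
    a • Ideal.span ({x} : Set R) = Ideal.span {a • x} := by
  rw [Ideal.smul_closure, Set.smul_set_singleton]

/-- The pointwise action of a group on ideals preserves being nonzero. [cite: AouissiMayerIsmailiTalbiAzizi2020, §2.1 and proof of Thm. 2.3 (ambiguous classes of k/k₀: 3 ∤ #C^{(σ)} ⟹ 3 ∤ h_k; Chevalley's step)] -/
theorem pointwise_smul_ne_bot (a : M) {I : Ideal R} (hI : I ≠ ⊥) : a • I ≠ ⊥ := by
  intro h
  apply hI
  rw [← Ideal.smul_bot a] at h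
  exact smul_left_cancel a h

variable [IsDedekindDomain R]

/-- `σ • I` is again a nonzero ideal (membership in the monoid `(Ideal R)⁰`). [cite: AouissiMayerIsmailiTalbiAzizi2020, §2.1 and proof of Thm. 2.3 (ambiguous classes of k/k₀: 3 ∤ #C^{(σ)} ⟹ 3 ∤ h_k; Chevalley's step)] -/
theorem smul_mem_nonZeroDivisors (a : M) (I : (Ideal R)⁰) : a • (I : Ideal R) ∈ (Ideal R)⁰ :=
  mem_nonZeroDivisors_of_ne_zero (pointwise_smul_ne_bot a (nonZeroDivisors.ne_zero I.2))

/-- `I ↦ σ • I` respects ideal classes: `(x)·I = (y)·I'` gives `(σx)·σI = (σy)·σI'`. [cite: AouissiMayerIsmailiTalbiAzizi2020, §2.1 and proof of Thm. 2.3 (ambiguous classes of k/k₀: 3 ∤ #C^{(σ)} ⟹ 3 ∤ h_k; Chevalley's step)] -/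
theorem mk0_smul_eq_of_mk0_eq (a : M) {I I' : (Ideal R)⁰}
    (h : ClassGroup.mk0 I = ClassGroup.mk0 I') :
    ClassGroup.mk0 ⟨a • (I : Ideal R), smul_mem_nonZeroDivisors a I⟩ =
      ClassGroup.mk0 ⟨a • (I' : Ideal R), smul_mem_nonZeroDivisors a I'⟩ := by
  rw [ClassGroup.mk0_eq_mk0_iff] at h ⊢
  obtain ⟨x, y, hx, hy, hxy⟩ := h
  refine ⟨a • x, a • y, (smul_ne_zero_iff_ne a).mpr hx, (smul_ne_zero_iff_ne a).mpr hy, ?_⟩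
  change Ideal.span {a • x} * a • (I : Ideal R) = Ideal.span {a • y} * a • (I' : Ideal R)
  rw [← pointwise_smul_span_singleton, ← pointwise_smul_span_singleton, ← smul_mul', ← smul_mul',
    hxy]

/-- The map `[I] ↦ [σ • I]` of the ideal class group induced by a ring automorphism `σ` exists
(as an endofunction of the underlying set; well defined by `mk0_smul_eq_of_mk0_eq`). [cite: AouissiMayerIsmailiTalbiAzizi2020, §2.1 and proof of Thm. 2.3 (ambiguous classes of k/k₀: 3 ∤ #C^{(σ)} ⟹ 3 ∤ h_k; Chevalley's step)] -/
theorem exists_classMap (a : M) : ∃ f : Function.End (ClassGroup R), ∀ I : (Ideal R)⁰,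
    f (ClassGroup.mk0 I) = ClassGroup.mk0 ⟨a • (I : Ideal R), smul_mem_nonZeroDivisors a I⟩ :=
  ⟨fun c => ClassGroup.mk0 ⟨a • _,
      smul_mem_nonZeroDivisors a (Function.surjInv ClassGroup.mk0_surjective c)⟩,
    fun I =>
      mk0_smul_eq_of_mk0_eq a (Function.surjInv_eq ClassGroup.mk0_surjective (ClassGroup.mk0 I))⟩

end ClassMap

/-! ### Units of `𝓞 L` lying in `F` -/

/-- An element of `F` which, in `L`, is a unit of `𝓞 L` is (the image of) a unit of `𝓞 F`:
integrality descends along the injection `F → L`, for the element and for its inverse.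
[cite: AouissiMayerIsmailiTalbiAzizi2020, §2.1 and proof of Thm. 2.3 (ambiguous classes of k/k₀: 3 ∤ #C^{(σ)} ⟹ 3 ∤ h_k; Chevalley's step)] -/
theorem exists_units_coe_eq_of_algebraMap_eq {F L : Type*} [Field F] [Field L] [Algebra F L]
    {a : F} (u : (𝓞 L)ˣ) (h : algebraMap F L a = ((u : 𝓞 L) : L)) :
    ∃ v : (𝓞 F)ˣ, ((v : 𝓞 F) : F) = a := by
  have hu0 : ((u : 𝓞 L) : L) ≠ 0 := RingOfIntegers.coe_ne_zero_iff.mpr u.ne_zero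
  have ha0 : a ≠ 0 := by
    rintro rfl
    rw [map_zero] at h
    exact hu0 h.symm
  have ha : IsIntegral ℤ a := by
    refine IsIntegral.tower_bot_of_field (B := L) ?_
    rw [h]
    exact RingOfIntegers.isIntegral_coe _
  have hb : IsIntegral ℤ a⁻¹ := by
    refine IsIntegral.tower_bot_of_field (B := L) ?_
    rw [map_inv₀, h, RingOfIntegers.coe_eq_algebraMap, ← map_units_inv]
    exact RingOfIntegers.isIntegral_coe _
  refine ⟨Units.mkOfMulEqOne (⟨a, ha⟩ : 𝓞 F) ⟨a⁻¹, hb⟩ ?_, rfl⟩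
  apply RingOfIntegers.coe_injective
  rw [map_mul, map_one, RingOfIntegers.map_mk, RingOfIntegers.map_mk, mul_inv_cancel₀ ha0]

/-! ### Cyclic cubic extensions: `σ³ = 1` and `N = x · σx · σ²x` -/

section Cubic

variable {F L : Type*} [Field F] [NumberField F] [Field L] [NumberField L] [Algebra F L]
  [IsGalois F L] {σ : L ≃ₐ[F] L}

/-- A generator of the Galois group of a cubic Galois extension has `σ³ = 1`. [cite: AouissiMayerIsmailiTalbiAzizi2020, §2.1 and proof of Thm. 2.3 (ambiguous classes of k/k₀: 3 ∤ #C^{(σ)} ⟹ 3 ∤ h_k; Chevalley's step)] -/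
theorem pow_three_eq_one_of_finrank_eq_three (hσ : ∀ τ : L ≃ₐ[F] L, τ ∈ Subgroup.zpowers σ)
    (h3 : Module.finrank F L = 3) : σ ^ 3 = 1 := by
  rw [← h3, ← IsGalois.card_aut_eq_finrank F L, ← orderOf_eq_card_of_forall_mem_zpowers hσ]
  exact pow_orderOf_eq_one σ

/-- In a cyclic cubic extension with group `⟨σ⟩`, `N_{L/F}(z) = z · σz · σ²z`. [cite: AouissiMayerIsmailiTalbiAzizi2020, §2.1 and proof of Thm. 2.3 (ambiguous classes of k/k₀: 3 ∤ #C^{(σ)} ⟹ 3 ∤ h_k; Chevalley's step)] -/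
theorem algebraMap_norm_eq_of_finrank_eq_three (hσ : ∀ τ : L ≃ₐ[F] L, τ ∈ Subgroup.zpowers σ)
    (h3 : Module.finrank F L = 3) (z : L) :
    algebraMap F L (Algebra.norm F z) = z * σ z * σ (σ z) := by
  rw [Algebra.norm_eq_prod_automorphisms,
    ← Literature.NumberTheory.GaloisRepresentations.CyclicNormIndex.prod_range_card_pow_eq_prod hσ
      (fun g => g z), IsGalois.card_aut_eq_finrank F L, h3]
  simp [Finset.prod_range_succ]

/-! ### An invariant class is trivial -/

/-- **Chevalley's ambiguous-class step.** Let `L/F` be cyclic cubic with group `⟨σ⟩` such that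
(i) every `x ∈ L` whose norm is a unit of `F` has the norm of a unit of `L` and (ii) every nonzero
`σ`-invariant ideal of `𝓞 L` is principal. Then every `σ`-invariant ideal class is trivial:
if `[σ • I] = [I]`, i.e. `(x)·σI = (y)·I`, then `N(y/x) ∈ 𝓞_Fˣ`, so by (i) and Hilbert 90
`y/x = ε σ(w)/w` with `w ∈ 𝓞 L`, `(w)·σI = (σw)·I`, and `J = (σw)(σ²w)·I` is a `σ`-invariant ideal
in the class of `I`, principal by (ii). [cite: AouissiMayerIsmailiTalbiAzizi2020, §2.1 and proof of Thm. 2.3 (ambiguous classes of k/k₀: 3 ∤ #C^{(σ)} ⟹ 3 ∤ h_k; Chevalley's step)] -/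
theorem mk0_eq_one_of_mk0_smul_eq (hσ : ∀ τ : L ≃ₐ[F] L, τ ∈ Subgroup.zpowers σ)
    (h3 : Module.finrank F L = 3)
    (hN : ∀ x : L, (∃ u : (𝓞 F)ˣ, Algebra.norm F x = ((u : 𝓞 F) : F)) →
      ∃ ε : (𝓞 L)ˣ, Algebra.norm F (((ε : 𝓞 L) : L)) = Algebra.norm F x)
    (hP : ∀ I : Ideal (𝓞 L), I ≠ ⊥ → σ • I = I → Submodule.IsPrincipal I)
    (I : (Ideal (𝓞 L))⁰)
    (h : ClassGroup.mk0 ⟨σ • (I : Ideal (𝓞 L)), smul_mem_nonZeroDivisors σ I⟩ = ClassGroup.mk0 I) :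
    ClassGroup.mk0 I = 1 := by
  classical
  have hσ3 : σ ^ 3 = 1 := pow_three_eq_one_of_finrank_eq_three hσ h3
  have hnorm : ∀ x : 𝓞 L,
      algebraMap F L (Algebra.norm F (x : L)) = ((x * σ • x * σ • σ • x : 𝓞 L) : L) := fun x => by
    rw [algebraMap_norm_eq_of_finrank_eq_three hσ h3]
    rfl
  obtain ⟨I, hI0⟩ := I
  have hI : I ≠ ⊥ := nonZeroDivisors.ne_zero hI0
  rw [ClassGroup.mk0_eq_mk0_iff] at h
  obtain ⟨x, y, hx, hy, hxy⟩ := h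
  change Ideal.span {x} * σ • I = Ideal.span {y} * I at hxy
  -- `σ³ = 1` on ideals and on integers
  have hσI : σ • σ • σ • I = I := by
    rw [smul_smul, smul_smul, ← pow_three', hσ3, one_smul]
  -- the two conjugate relations
  have h1 : Ideal.span {σ • x} * σ • σ • I = Ideal.span {σ • y} * σ • I := by
    have := congrArg (σ • ·) hxy
    simpa only [smul_mul', pointwise_smul_span_singleton] using this
  have h2 : Ideal.span {σ • σ • x} * I = Ideal.span {σ • σ • y} * σ • σ • I := by
    have := congrArg (σ • ·) h1
    simpa only [smul_mul', pointwise_smul_span_singleton, hσI] using this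
  -- multiply the three relations and cancel `I · σI · σ²I`
  have hII : I * σ • I * σ • σ • I ≠ 0 :=
    mul_ne_zero (mul_ne_zero hI (pointwise_smul_ne_bot σ hI))
      (pointwise_smul_ne_bot σ (pointwise_smul_ne_bot σ hI))
  have hNN : Ideal.span {x * σ • x * σ • σ • x} = Ideal.span {y * σ • y * σ • σ • y} := by
    apply mul_right_cancel₀ hII
    calc Ideal.span {x * σ • x * σ • σ • x} * (I * σ • I * σ • σ • I)
        = (Ideal.span {x} * σ • I) * (Ideal.span {σ • x} * σ • σ • I) *
            (Ideal.span {σ • σ • x} * I) := by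
          rw [← Ideal.span_singleton_mul_span_singleton, ← Ideal.span_singleton_mul_span_singleton]
          ring
      _ = (Ideal.span {y} * I) * (Ideal.span {σ • y} * σ • I) *
            (Ideal.span {σ • σ • y} * σ • σ • I) := by rw [hxy, h1, h2]
      _ = Ideal.span {y * σ • y * σ • σ • y} * (I * σ • I * σ • σ • I) := by
          rw [← Ideal.span_singleton_mul_span_singleton, ← Ideal.span_singleton_mul_span_singleton]
          ring
  obtain ⟨u, hu⟩ := Ideal.span_singleton_eq_span_singleton.mp hNN
  -- in `L`: `N(y/x) = u` is a unit of `𝓞 L` lying in `F`, hence a unit of `𝓞 F`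
  have hx' : (x : L) ≠ 0 := RingOfIntegers.coe_ne_zero_iff.mpr hx
  have hNx0 : ((x * σ • x * σ • σ • x : 𝓞 L) : L) ≠ 0 :=
    RingOfIntegers.coe_ne_zero_iff.mpr
      (mul_ne_zero (mul_ne_zero hx ((smul_ne_zero_iff_ne σ).mpr hx))
        ((smul_ne_zero_iff_ne σ).mpr ((smul_ne_zero_iff_ne σ).mpr hx)))
  have hdiv : ∀ a b : L, Algebra.norm F (a / b) = Algebra.norm F a / Algebra.norm F b :=
    fun a b => by rw [div_eq_mul_inv, map_mul, Algebra.norm_inv, div_eq_mul_inv]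
  have hz : algebraMap F L (Algebra.norm F ((y : L) / x)) = ((u : 𝓞 L) : L) := by
    rw [hdiv, map_div₀, hnorm, hnorm, ← hu, div_eq_iff hNx0]
    exact (map_mul _ _ _).trans (mul_comm _ _)
  obtain ⟨v, hv⟩ := exists_units_coe_eq_of_algebraMap_eq u hz
  -- by (i), `N(y/x) = N(ε)` for a unit `ε` of `𝓞 L`; then `y/(xε)` has norm `1`
  obtain ⟨ε, hε⟩ := hN ((y : L) / x) ⟨v, hv.symm⟩
  have hε0 : ((ε : 𝓞 L) : L) ≠ 0 := RingOfIntegers.coe_ne_zero_iff.mpr ε.ne_zero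
  have hz0 : Algebra.norm F ((y : L) / x) ≠ 0 := by
    intro h0
    rw [h0, map_zero] at hz
    exact (RingOfIntegers.coe_ne_zero_iff.mpr u.ne_zero) hz.symm
  have h1' : Algebra.norm F ((y : L) / x / ε) = 1 := by
    rw [hdiv, hε, div_self hz0]
  -- Hilbert 90, and an integral representative `w`
  obtain ⟨w₀, hw₀, hw₀'⟩ :=
    Literature.NumberTheory.GaloisRepresentations.CyclicNormIndex.exists_eq_div_of_norm_eq_one
      hσ h1'
  obtain ⟨d, hd, hdint⟩ := exists_integral_multiples ℤ ℚ ({w₀} : Finset L)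
  have hdw : IsIntegral ℤ ((d : L) * w₀) := by
    have := hdint w₀ (Finset.mem_singleton_self w₀)
    rwa [Algebra.smul_def, eq_intCast] at this
  set w : 𝓞 L := ⟨(d : L) * w₀, hdw⟩ with hwdef
  have hw : (w : L) = (d : L) * w₀ := rfl
  have hd' : (d : L) ≠ 0 := Int.cast_ne_zero.mpr hd
  have hwne : (w : L) ≠ 0 := by rw [hw]; exact mul_ne_zero hd' hw₀
  have hwne' : w ≠ 0 := RingOfIntegers.coe_ne_zero_iff.mp hwne
  have hσw : σ (w : L) / w = σ w₀ / w₀ := by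
    rw [hw, map_mul, map_intCast, mul_div_mul_left _ _ hd']
  -- `w · y = x · ε · σw` in `𝓞 L`
  have hrel : (w : L) * y = x * (ε * σ (w : L)) := by
    have h := hw₀'.trans hσw.symm
    rw [div_div, div_eq_div_iff (mul_ne_zero hx' hε0) hwne] at h
    linear_combination h
  have hrelO : w * y = x * ((ε : 𝓞 L) * σ • w) := by
    apply RingOfIntegers.coe_injective
    simp only [map_mul]
    exact hrel
  -- `(w)·σI = (σw)·I`
  have hwI : Ideal.span {w} * σ • I = Ideal.span {σ • w} * I := by
    have hsx : Ideal.span ({x} : Set (𝓞 L)) ≠ 0 := by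
      rw [Ne, Ideal.zero_eq_bot, Ideal.span_singleton_eq_bot]
      exact hx
    apply mul_left_cancel₀ hsx
    calc Ideal.span {x} * (Ideal.span {w} * σ • I)
        = Ideal.span {w} * (Ideal.span {x} * σ • I) := by ring
      _ = Ideal.span {w} * (Ideal.span {y} * I) := by rw [hxy]
      _ = Ideal.span {w * y} * I := by rw [← mul_assoc, Ideal.span_singleton_mul_span_singleton]
      _ = Ideal.span {x * ((ε : 𝓞 L) * σ • w)} * I := by rw [hrelO]
      _ = Ideal.span {x} * (Ideal.span {σ • w} * I) := by
          rw [← Ideal.span_singleton_mul_span_singleton,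
            Ideal.span_singleton_mul_left_unit ε.isUnit, mul_assoc]
  -- the invariant ideal `J = (σw)(σ²w)·I` in the class of `I`
  have hσw3 : σ • σ • σ • w = w := by
    rw [smul_smul, smul_smul, ← pow_three', hσ3, one_smul]
  set J : Ideal (𝓞 L) := Ideal.span {σ • w} * Ideal.span {σ • σ • w} * I with hJ
  have hJσ : σ • J = J := by
    rw [hJ, smul_mul', smul_mul', pointwise_smul_span_singleton, pointwise_smul_span_singleton,
      hσw3, mul_assoc, hwI, ← mul_assoc, mul_comm (Ideal.span {σ • σ • w})]
  have hsw : ∀ t : 𝓞 L, t ≠ 0 → Ideal.span ({t} : Set (𝓞 L)) ≠ ⊥ := fun t ht => by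
    rw [Ne, Ideal.span_singleton_eq_bot]
    exact ht
  have hw1 : σ • w ≠ 0 := (smul_ne_zero_iff_ne σ).mpr hwne'
  have hw2 : σ • σ • w ≠ 0 := (smul_ne_zero_iff_ne σ).mpr hw1
  have hJ0 : J ≠ ⊥ := mul_ne_zero (mul_ne_zero (hsw _ hw1) (hsw _ hw2)) hI
  have hJmem : J ∈ (Ideal (𝓞 L))⁰ := mem_nonZeroDivisors_of_ne_zero hJ0
  have hIJ : ClassGroup.mk0 ⟨I, hI0⟩ = ClassGroup.mk0 ⟨J, hJmem⟩ := by
    rw [ClassGroup.mk0_eq_mk0_iff]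
    refine ⟨σ • w * σ • σ • w, 1, mul_ne_zero hw1 hw2, one_ne_zero, ?_⟩
    show Ideal.span {σ • w * σ • σ • w} * I = Ideal.span {1} * J
    rw [Ideal.span_singleton_one, Ideal.top_mul, hJ, ← Ideal.span_singleton_mul_span_singleton]
  rw [hIJ]
  exact (ClassGroup.mk0_eq_one_iff hJmem).mpr (hP J hJ0 hJσ)

end Cubic

/-! ### `3 ∤ h_L` -/

/-- **`3 ∤ h_L` (Chevalley's ambiguous-class count).** For a cyclic cubic extension `L/F` of
number fields with group `⟨σ⟩` satisfying (i) every element of `L` whose norm is a unit of `F`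
has the norm of a unit of `L` and (ii) every nonzero `σ`-invariant ideal of `𝓞 L` is principal,
the class number of `L` is prime to `3`: by `mk0_eq_one_of_mk0_smul_eq` the only `σ`-fixed
ideal class is `1`, and `[I] ↦ [σ • I]` is an endofunction `f` of the finite set `Cl(L)` with
`f³ = 1`, so `h_L ≡ #Fix(f) = 1 (mod 3)` (`Equiv.Perm.card_fixedPoints_modEq`). [cite: AouissiMayerIsmailiTalbiAzizi2020, §2.1 and proof of Thm. 2.3 (ambiguous classes of k/k₀: 3 ∤ #C^{(σ)} ⟹ 3 ∤ h_k; Chevalley's step)] -/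
theorem classNumber_not_dvd :
    ∀ (F L : Type) [Field F] [NumberField F] [Field L] [NumberField L] [Algebra F L]
      [IsGalois F L] (σ : L ≃ₐ[F] L), (∀ τ : L ≃ₐ[F] L, τ ∈ Subgroup.zpowers σ) →
      Module.finrank F L = 3 →
      (∀ x : L, (∃ u : (𝓞 F)ˣ, Algebra.norm F x = ((u : 𝓞 F) : F)) →
        ∃ ε : (𝓞 L)ˣ, Algebra.norm F (((ε : 𝓞 L) : L)) = Algebra.norm F x) →
      (∀ I : Ideal (𝓞 L), I ≠ ⊥ → σ • I = I → Submodule.IsPrincipal I) →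
      ¬ 3 ∣ classNumber L := by
  intro F L _ _ _ _ _ _ σ hσ h3 hN hP
  classical
  have hσ3 : σ ^ 3 = 1 := pow_three_eq_one_of_finrank_eq_three hσ h3
  -- `f = ([I] ↦ [σ • I])` has `f ^ 3 = 1` ...
  obtain ⟨f, hf⟩ := exists_classMap (R := 𝓞 L) σ
  have hf3 : f ^ 3 ^ 1 = 1 := by
    rw [pow_one]
    funext c
    obtain ⟨I, rfl⟩ := ClassGroup.mk0_surjective c
    show f (f (f (ClassGroup.mk0 I))) = ClassGroup.mk0 I
    rw [hf, hf, hf]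
    congr 1
    refine Subtype.ext ?_
    show σ • σ • σ • (I : Ideal (𝓞 L)) = I
    rw [smul_smul, smul_smul, ← pow_three', hσ3, one_smul]
  have hmod := Equiv.Perm.card_fixedPoints_modEq hf3
  -- ... and exactly one fixed point
  have hone : Fintype.card (Function.fixedPoints f) = 1 := by
    rw [Fintype.card_eq_one_iff]
    refine ⟨⟨1, ?_⟩, ?_⟩
    · show f 1 = 1
      rw [← map_one ClassGroup.mk0, hf]
      congr 1
      exact Subtype.ext (smul_one σ)
    · rintro ⟨c, hc⟩
      obtain ⟨I, rfl⟩ := ClassGroup.mk0_surjective c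
      refine Subtype.ext (mk0_eq_one_of_mk0_smul_eq hσ h3 hN hP I ?_)
      rw [← hf]
      exact hc
  rw [hone] at hmod
  intro hdvd
  unfold classNumber at hdvd
  unfold Nat.ModEq at hmod
  omega

end Literature.NumberTheory.NumberFields.Honda1971

end Part2

/-!
## Part 3 — port of `Summits/QuantumAdvantage/QuantumAdvantage/Theorems/LinnikCubicClassGroupsPureCubicClassNumberHardDescentGalois.lean`

# The Galois group of `K(ζ₃)/ℚ` for a cubic field `K ∋ ∛m`: `τστ = σ²`

Infrastructure for the Hasse-free DESCENT `3 ∣ h(K(ζ₃)) ⟹ 3 ∣ h(K)`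
of Honda's criterion (Part `Descent` below).

For a cubic number field `K` (no primitive cube root of unity, cube roots unique), the quadratic
Galois extension `L = K(ζ₃)` with `Gal(L/K) = {1, τ}`, and the quadratic subfield `F = ℚ(ζ₃)` with
`Gal(L/F) = ⟨σ⟩` cyclic of order `3`:

* `algEquiv_eq_one_or_eq_of_finrank_eq_two`, `exists_algEquiv_ne_one_of_finrank_eq_two`,
  `mul_self_eq_one_of_finrank_eq_two`, `exists_algebraMap_eq_of_fixed` — `Gal(L/K) = {1, τ}`,
  `τ² = 1`, `τ`-fixed elements lie in `K`;
* `sq_add_self_add_one_ne_zero`, `eq_of_pow_three_eq` — a cubic field has no root of `X² + X + 1`,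
  so cube roots in it are unique;
* `algEquiv_eq_of_forall_mem_zpowers` — `Gal(L/F) = {1, σ, σ²}`;
* `apply_apply_eq_of_generators` — **`τσ = σ²τ`** (the group `Gal(L/ℚ) ≅ S₃` is not abelian):
  `ρ = τστ` fixes the normal subfield `F`, so `ρ ∈ {1, σ, σ²}`; `ρ = 1` forces `σ = 1`, `ρ = σ`
  makes `σ(∛m)` a `τ`-fixed cube root of `m`, i.e. `σ(∛m) = ∛m`; and `apply_apply_apply_eq`
  (`τσ² = στ`).

## References
* T. Honda, *Pure cubic fields whose class numbers are multiples of three*, J. Number Theory 3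
  (1971) 7–12. [Honda1971]
-/

section Part3

open _root_.NumberField _root_.Polynomial

open scoped _root_.Pointwise _root_.NumberField nonZeroDivisors

namespace Literature.NumberTheory.NumberFields.Honda1971

open Literature.NumberTheory.NumberFields

variable {K L : Type*} [Field K] [NumberField K] [Field L] [NumberField L] [Algebra K L]

/-! ### Quadratic Galois extensions -/

/-- In a Galois extension of degree `2` with a nontrivial automorphism `τ`, every automorphism is
`1` or `τ`. [cite: Honda1971, Theorem (Galois group of ℚ(∛m, ζ₃)/ℚ ≅ S₃; descent infrastructure)] -/
theorem algEquiv_eq_one_or_eq_of_finrank_eq_two [IsGalois K L] (h2 : Module.finrank K L = 2)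
    {τ : L ≃ₐ[K] L} (hτ : τ ≠ 1) (g : L ≃ₐ[K] L) : g = 1 ∨ g = τ := by
  classical
  by_contra! h
  have hcard : Fintype.card (L ≃ₐ[K] L) = 2 := by
    rw [← Nat.card_eq_fintype_card, IsGalois.card_aut_eq_finrank, h2]
  have hle : ({1, τ, g} : Finset (L ≃ₐ[K] L)).card ≤ 2 := hcard ▸ Finset.card_le_univ _
  rw [Finset.card_insert_of_notMem, Finset.card_pair (fun h' => h.2 h'.symm)] at hle
  · omega
  · simp only [Finset.mem_insert, Finset.mem_singleton, not_or]
    exact ⟨fun h' => hτ h'.symm, fun h' => h.1 h'.symm⟩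

/-- A quadratic Galois extension has a nontrivial automorphism. [cite: Honda1971, Theorem (Galois group of ℚ(∛m, ζ₃)/ℚ ≅ S₃; descent infrastructure)] -/
theorem exists_algEquiv_ne_one_of_finrank_eq_two [IsGalois K L] (hKL : Module.finrank K L = 2) :
    ∃ τ : L ≃ₐ[K] L, τ ≠ 1 := by
  classical
  have hcard : 1 < Fintype.card (L ≃ₐ[K] L) := by
    rw [← Nat.card_eq_fintype_card, IsGalois.card_aut_eq_finrank, hKL]
    norm_num
  exact Fintype.exists_ne_of_one_lt_card hcard 1

/-- The nontrivial automorphism of a quadratic Galois extension is an involution. [cite: Honda1971, Theorem (Galois group of ℚ(∛m, ζ₃)/ℚ ≅ S₃; descent infrastructure)] -/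
theorem mul_self_eq_one_of_finrank_eq_two [IsGalois K L] (hKL : Module.finrank K L = 2)
    {τ : L ≃ₐ[K] L} (hτ : τ ≠ 1) : τ * τ = 1 := by
  rcases algEquiv_eq_one_or_eq_of_finrank_eq_two hKL hτ (τ * τ) with h | h
  · exact h
  · exact absurd (mul_eq_left.mp h) hτ

/-- In a quadratic Galois extension `L/K` with `Gal = {1, τ}`, a `τ`-fixed element lies in `K`.
[cite: Honda1971, Theorem (Galois group of ℚ(∛m, ζ₃)/ℚ ≅ S₃; descent infrastructure)] -/
theorem exists_algebraMap_eq_of_fixed [IsGalois K L] (hKL : Module.finrank K L = 2)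
    {τ : L ≃ₐ[K] L} (hτ : τ ≠ 1) {z : L} (hz : τ z = z) : ∃ k : K, algebraMap K L k = z := by
  refine (IsGalois.mem_range_algebraMap_iff_fixed (F := K) z).mpr fun g => ?_
  rcases algEquiv_eq_one_or_eq_of_finrank_eq_two hKL hτ g with rfl | rfl
  · rfl
  · exact hz

/-! ### Cubic fields contain no primitive cube root of unity -/

/-- A cubic number field contains no root of `X² + X + 1`. [cite: Honda1971, Theorem (Galois group of ℚ(∛m, ζ₃)/ℚ ≅ S₃; descent infrastructure)] -/
theorem sq_add_self_add_one_ne_zero (hK : Module.finrank ℚ K = 3) (k : K) :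
    k ^ 2 + k + 1 ≠ 0 := by
  intro h
  have hirr := irreducible_cyclotomic_three_of_finrank_eq_three hK
  have hroot : (cyclotomic 3 K).IsRoot k := by
    rw [cyclotomic_three, IsRoot.def]
    simp only [eval_add, eval_pow, eval_X, eval_one]
    exact h
  have hdeg := degree_eq_one_of_irreducible_of_root hirr hroot
  have h2 : (cyclotomic 3 K).natDegree = 2 := by
    rw [natDegree_cyclotomic, Nat.totient_prime Nat.prime_three]
  have h1 : (cyclotomic 3 K).natDegree = 1 := natDegree_eq_of_degree_eq_some hdeg
  omega

/-- **Cube roots are unique in a cubic number field**: `k³ = θ³ ≠ 0` forces `k = θ`. [cite: Honda1971, Theorem (Galois group of ℚ(∛m, ζ₃)/ℚ ≅ S₃; descent infrastructure)] -/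
theorem eq_of_pow_three_eq (hK : Module.finrank ℚ K = 3) {k θ : K} (hθ : θ ≠ 0)
    (h : k ^ 3 = θ ^ 3) : k = θ := by
  have hfac : (k - θ) * (k ^ 2 + k * θ + θ ^ 2) = 0 := by linear_combination h
  rcases mul_eq_zero.mp hfac with h1 | h2
  · exact sub_eq_zero.mp h1
  · exfalso
    apply sq_add_self_add_one_ne_zero hK (k / θ)
    field_simp
    linear_combination h2

/-! ### Cyclic cubic extensions: the three automorphisms -/

/-- In a cyclic cubic extension with generator `σ`, every automorphism is `1`, `σ` or `σ²`.
[cite: Honda1971, Theorem (Galois group of ℚ(∛m, ζ₃)/ℚ ≅ S₃; descent infrastructure)] -/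
theorem algEquiv_eq_of_forall_mem_zpowers (F : IntermediateField ℚ L) [IsGalois F L]
    {σ : L ≃ₐ[F] L} (hσ : ∀ τ : L ≃ₐ[F] L, τ ∈ Subgroup.zpowers σ)
    (hFL : Module.finrank F L = 3) (g : L ≃ₐ[F] L) : g = 1 ∨ g = σ ∨ g = σ * σ := by
  have hσ3 := pow_three_eq_one_of_finrank_eq_three hσ hFL
  have hσ1 : σ ≠ 1 := by
    intro h1
    have hcard : Nat.card (L ≃ₐ[F] L) = 3 := by rw [IsGalois.card_aut_eq_finrank, hFL]
    rw [← orderOf_eq_card_of_forall_mem_zpowers hσ, h1, orderOf_one] at hcard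
    norm_num at hcard
  haveI : Fact (Nat.Prime 3) := ⟨Nat.prime_three⟩
  have hord : orderOf σ = 3 := orderOf_eq_prime hσ3 hσ1
  obtain ⟨k, rfl⟩ := Subgroup.mem_zpowers_iff.mp (hσ g)
  have hk : σ ^ k = σ ^ (k % 3) := by
    rw [← zpow_mod_orderOf, hord]
    rfl
  have h0 : 0 ≤ k % 3 := Int.emod_nonneg _ (by norm_num)
  have h3 : k % 3 < 3 := Int.emod_lt_of_pos _ (by norm_num)
  rw [hk]
  interval_cases (k % 3)
  · left
    exact zpow_zero σ
  · right
    left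
    exact zpow_one σ
  · right
    right
    rw [show (2 : ℤ) = ((2 : ℕ) : ℤ) from rfl, zpow_natCast, pow_two]

/-! ### `τσ = σ²τ` -/

/-- **The Galois group of `L = K(ζ₃)` over `ℚ` is not abelian: `τστ = σ²`.**  Here `K` is a
cubic field with an element `θ` (`θ³ = m ≠ 0`) moved by the generator `σ` of `Gal(L/F)`,
`F ⊆ L` the quadratic subfield `ℚ(ζ₃)` (normal over `ℚ`), and `τ` generates `Gal(L/K)`.
Proof: `ρ = τστ` fixes `F`, so `ρ ∈ {1, σ, σ²}`; `ρ = 1` forces `σ = 1`, and `ρ = σ` forces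
`σθ` to be `τ`-fixed, i.e. a cube root of `m` in `K`, i.e. `σθ = θ`. [cite: Honda1971, Theorem (Galois group of ℚ(∛m, ζ₃)/ℚ ≅ S₃; descent infrastructure)] -/
theorem apply_apply_eq_of_generators (hK : Module.finrank ℚ K = 3) [IsGalois ℚ L] [IsGalois K L]
    (hKL : Module.finrank K L = 2) {τ : L ≃ₐ[K] L} (hτ : τ ≠ 1)
    (F : IntermediateField ℚ L) [IsGalois F L] (hF2 : Module.finrank ℚ F = 2)
    {ζ : 𝓞 F} (hζ : ζ ^ 2 + ζ + 1 = 0)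
    {σ : L ≃ₐ[F] L} (hσ : ∀ g : L ≃ₐ[F] L, g ∈ Subgroup.zpowers σ)
    (hFL : Module.finrank F L = 3) {θ : K} {m : ℕ} (hm : m ≠ 0) (hθ3 : θ ^ 3 = (m : K))
    (hθσ : σ (algebraMap K L θ) ≠ algebraMap K L θ) (z : L) :
    τ (σ z) = σ (σ (τ z)) := by
  classical
  haveI := Honda1971.isCyclotomicExtension_three F hF2 hζ
  haveI : IsGalois ℚ F := IsCyclotomicExtension.isGalois {3} ℚ F
  have hFmap : ∀ (φ : L ≃ₐ[ℚ] L) (f : F), φ (f : L) ∈ F := by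
    intro φ f
    have hn : Normal ℚ F := inferInstance
    exact (IntermediateField.normal_iff_forall_map_le'.mp hn φ) ⟨f, f.2, rfl⟩
  have hττ : ∀ w : L, τ (τ w) = w := fun w => by
    rw [← AlgEquiv.mul_apply, mul_self_eq_one_of_finrank_eq_two hKL hτ, AlgEquiv.one_apply]
  let τℚ : L ≃ₐ[ℚ] L := τ.restrictScalars ℚ
  let σℚ : L ≃ₐ[ℚ] L := σ.restrictScalars ℚ
  let ρ₀ : L ≃ₐ[ℚ] L := τℚ.trans (σℚ.trans τℚ)
  have hρ₀ : ∀ w, ρ₀ w = τ (σ (τ w)) := fun w => rfl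
  have hfixF : ∀ f : F, ρ₀.toRingEquiv (algebraMap F L f) = algebraMap F L f := by
    intro f
    change ρ₀ (f : L) = f
    rw [hρ₀]
    have hmem : τ (f : L) ∈ F := hFmap τℚ f
    have : σ (τ (f : L)) = τ f := σ.commutes ⟨τ f, hmem⟩
    rw [this, hττ]
  let g : L ≃ₐ[F] L := AlgEquiv.ofRingEquiv hfixF
  have hg : ∀ w, g w = τ (σ (τ w)) := fun w => rfl
  rcases algEquiv_eq_of_forall_mem_zpowers F hσ hFL g with h1 | h2 | h3
  · -- `ρ = 1` would force `σ = 1`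
    exfalso
    have hσ1 : σ = 1 := by
      ext w
      have := hg (τ w)
      rw [h1, hττ, AlgEquiv.one_apply] at this
      exact τ.injective this.symm
    have hcard : Nat.card (L ≃ₐ[F] L) = 3 := by
      rw [IsGalois.card_aut_eq_finrank, hFL]
    rw [← orderOf_eq_card_of_forall_mem_zpowers hσ, hσ1, orderOf_one] at hcard
    norm_num at hcard
  · -- `ρ = σ`: then `σθ` is `τ`-fixed, a cube root of `m` in `K`
    exfalso
    set α : L := algebraMap K L θ with hαdef
    have hτα : τ α = α := τ.commutes θ
    have hα3 : α ^ 3 = (m : L) := by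
      rw [hαdef, ← map_pow, hθ3, map_natCast]
    have h' : τ (σ α) = σ α := by
      have := hg α
      rw [h2, hτα] at this
      exact this.symm
    obtain ⟨k, hk⟩ := exists_algebraMap_eq_of_fixed hKL hτ h'
    have hθ0 : θ ≠ 0 := by
      intro h0
      rw [h0, zero_pow three_ne_zero] at hθ3
      exact hm (by exact_mod_cast hθ3.symm)
    have hk3 : k ^ 3 = θ ^ 3 := by
      apply (algebraMap K L).injective
      rw [map_pow, hk, ← map_pow, hα3, map_natCast, map_pow, ← hαdef, hα3]
    have := eq_of_pow_three_eq hK hθ0 hk3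
    rw [this] at hk
    exact hθσ hk.symm
  · have := hg (τ z)
    rw [h3, hττ, AlgEquiv.mul_apply] at this
    exact this.symm

omit [NumberField K] in
/-- `τσ² = στ` (from `τσ = σ²τ` and `σ³ = 1`). [cite: Honda1971, Theorem (Galois group of ℚ(∛m, ζ₃)/ℚ ≅ S₃; descent infrastructure)] -/
theorem apply_apply_apply_eq (F : IntermediateField ℚ L) [IsGalois F L]
    {σ : L ≃ₐ[F] L} (hσ : ∀ g : L ≃ₐ[F] L, g ∈ Subgroup.zpowers σ)
    (hFL : Module.finrank F L = 3) {τ : L ≃ₐ[K] L}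
    (hτσ : ∀ z : L, τ (σ z) = σ (σ (τ z))) (z : L) : τ (σ (σ z)) = σ (τ z) := by
  have hσ3 := pow_three_eq_one_of_finrank_eq_three hσ hFL
  have hσσσ : ∀ w, σ (σ (σ w)) = w := fun w => by
    rw [← AlgEquiv.mul_apply, ← AlgEquiv.mul_apply, ← pow_three', hσ3, AlgEquiv.one_apply]
  rw [hτσ, hτσ, hσσσ]

end Literature.NumberTheory.NumberFields.Honda1971

end Part3

/-!
## Part 4 — port of `Summits/QuantumAdvantage/QuantumAdvantage/Theorems/LinnikCubicClassGroupsPureCubicClassNumberHardRelNormQuadratic.lean`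

# Relative norms in a quadratic Galois extension: `N_{L/K}(𝔄)𝓞_L = 𝔄 · τ𝔄`

Infrastructure for the Hasse-free DESCENT `3 ∣ h(K(ζ₃)) ⟹ 3 ∣ h(K)`
of Honda's criterion (Part `Descent` below).

For number fields `K ⊆ L` with `L/K` Galois of degree `2`, `Gal(L/K) = {1, τ}`:
* `map_relNorm_eq_mul_smul_of_isMaximal` — `N_{L/K}(𝔓)𝓞_L = 𝔓 · τ𝔓` for a prime `𝔓` (the
  fundamental identity `∑ e f = 2` and transitivity of `Gal(L/K)` on the primes over `𝔓 ∩ 𝓞_K`);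
* `map_relNorm_eq_mul_smul` — the same for every ideal (multiplicativity of `Ideal.relNorm`);
* `mk0_mul_smul_pow_classNumber` — hence `[𝔄 · τ𝔄]^{h_K} = 1` in `Cl(L)`.

## References
* T. Honda, *Pure cubic fields whose class numbers are multiples of three*, J. Number Theory 3
  (1971) 7–12, Theorem. [Honda1971]
* S. Aouissi, D. C. Mayer, M. C. Ismaili, M. Talbi, A. Azizi, *3-rank of ambiguous class groups of
  cubic Kummer extensions*, Period. Math. Hungar. 81 (2020), Thm. 2.3. [AouissiMayerIsmailiTalbiAzizi2020]
-/

section Part4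

open _root_.NumberField

open scoped _root_.Pointwise _root_.NumberField nonZeroDivisors

namespace Literature.NumberTheory.NumberFields.Honda1971

variable {K L : Type*} [Field K] [NumberField K] [Field L] [NumberField L] [Algebra K L]

/-- **`N_{L/K}(𝔓)𝓞_L = 𝔓 · τ𝔓` for a prime `𝔓`** of a quadratic Galois extension `L/K` with
`Gal(L/K) = {1, τ}`: if `τ𝔓 = 𝔓` then `𝔓` is the only prime over `𝔭 = 𝔓 ∩ 𝓞_K` and
`e f = 2`, so `𝔭^f 𝓞_L = 𝔓^{ef} = 𝔓²`; otherwise `𝔭𝓞_L = 𝔓 · τ𝔓` with `e = f = 1`. [cite: Honda1971, Theorem (relative norm of ideals in the quadratic layer k/L; descent infrastructure)] -/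
theorem map_relNorm_eq_mul_smul_of_isMaximal [IsGalois K L] (h2 : Module.finrank K L = 2)
    {τ : L ≃ₐ[K] L} (hτ : τ ≠ 1) (P : Ideal (𝓞 L)) [hP : P.IsMaximal] :
    (Ideal.relNorm (𝓞 K) P).map (algebraMap (𝓞 K) (𝓞 L)) = P * τ • P := by
  classical
  set p := P.under (𝓞 K) with hpdef
  haveI hpmax : p.IsMaximal := Ideal.IsMaximal.under (𝓞 K) P
  haveI : P.LiesOver p := ⟨rfl⟩
  have hP0 : P ≠ ⊥ := Ideal.IsMaximal.ne_bot_of_isIntegral_int P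
  have hp0 : p ≠ ⊥ := mt Ideal.eq_bot_of_comap_eq_bot hP0
  have hsum : ∑ Q ∈ (p.primesOver (𝓞 L)).toFinset, Q.ramificationIdx (𝓞 K) * Q.inertiaDeg (𝓞 K)
      = 2 := by
    rw [← Finset.sum_set_coe, ← h2, ← IsGalois.card_aut_eq_finrank]
    exact Ideal.sum_ramification_inertia_eq_card p (𝓞 L) (G := L ≃ₐ[K] L)
  rw [Ideal.relNorm_eq_pow_of_isMaximal P p, Ideal.map_pow,
    Ideal.map_algebraMap_eq_finsetProd_pow hp0]
  have hmemP : P ∈ (p.primesOver (𝓞 L)).toFinset := by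
    rw [Set.mem_toFinset]
    exact ⟨hP.isPrime, ⟨rfl⟩⟩
  haveI : (τ • P).IsPrime := hP.isPrime.smul τ
  have hmemτ : τ • P ∈ (p.primesOver (𝓞 L)).toFinset := by
    rw [Set.mem_toFinset]
    exact ⟨inferInstance, ⟨by rw [Ideal.under_smul]⟩⟩
  -- every prime over `p` is `P` or `τ • P`
  have hall : ∀ Q ∈ (p.primesOver (𝓞 L)).toFinset, Q = P ∨ Q = τ • P := by
    intro Q hQ
    rw [Set.mem_toFinset] at hQ
    haveI := hQ.1
    haveI := hQ.2
    obtain ⟨g, hg⟩ := Ideal.exists_smul_eq_of_isGaloisGroup p P Q (L ≃ₐ[K] L)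
    rcases algEquiv_eq_one_or_eq_of_finrank_eq_two h2 hτ g with rfl | rfl
    · left
      rw [← hg, one_smul]
    · right
      exact hg.symm
  -- positivity of `e` and `f`
  have hepos : ∀ Q ∈ (p.primesOver (𝓞 L)).toFinset, 0 < Q.ramificationIdx (𝓞 K) := by
    intro Q hQ
    rw [Set.mem_toFinset] at hQ
    haveI := hQ.1
    haveI := hQ.2
    exact Ideal.ramificationIdx_pos Q (𝓞 K)
  have hfpos : ∀ Q ∈ (p.primesOver (𝓞 L)).toFinset, 0 < Q.inertiaDeg (𝓞 K) := by
    intro Q hQ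
    rw [Set.mem_toFinset] at hQ
    haveI := hQ.1
    haveI := hQ.2
    exact Ideal.inertiaDeg_pos Q (𝓞 K)
  by_cases hfix : τ • P = P
  · -- `P` is the only prime over `p`
    have hset : (p.primesOver (𝓞 L)).toFinset = {P} := by
      ext Q
      simp only [Finset.mem_singleton]
      constructor
      · intro hQ
        rcases hall Q hQ with h | h
        · exact h
        · rw [h, hfix]
      · rintro rfl
        exact hmemP
    rw [hset, Finset.sum_singleton] at hsum
    rw [hset, Finset.prod_singleton, hfix, ← pow_mul, hsum, sq]
  · -- `P ≠ τ • P`: both appear, with `e = f = 1`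
    have hne : P ≠ τ • P := fun h => hfix h.symm
    have hset : (p.primesOver (𝓞 L)).toFinset = {P, τ • P} := by
      ext Q
      simp only [Finset.mem_insert, Finset.mem_singleton]
      exact ⟨fun hQ => hall Q hQ, fun h => by rcases h with rfl | rfl <;> assumption⟩
    rw [hset, Finset.sum_pair hne] at hsum
    have heτ : (τ • P).ramificationIdx (𝓞 K) = P.ramificationIdx (𝓞 K) :=
      Ideal.ramificationIdx_smul (𝓞 K) P τ
    have h1 : 1 ≤ P.ramificationIdx (𝓞 K) * P.inertiaDeg (𝓞 K) :=
      Nat.one_le_iff_ne_zero.mpr (Nat.mul_ne_zero (hepos P hmemP).ne' (hfpos P hmemP).ne')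
    have h2' : 1 ≤ (τ • P).ramificationIdx (𝓞 K) * (τ • P).inertiaDeg (𝓞 K) :=
      Nat.one_le_iff_ne_zero.mpr (Nat.mul_ne_zero (hepos _ hmemτ).ne' (hfpos _ hmemτ).ne')
    have hef : P.ramificationIdx (𝓞 K) * P.inertiaDeg (𝓞 K) = 1 := by omega
    have he : P.ramificationIdx (𝓞 K) = 1 := Nat.eq_one_of_mul_eq_one_right hef
    have hf : P.inertiaDeg (𝓞 K) = 1 := Nat.eq_one_of_mul_eq_one_left hef
    rw [hset, Finset.prod_pair hne, heτ, he, hf, pow_one, pow_one, pow_one]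

/-- **`N_{L/K}(𝔄)𝓞_L = 𝔄 · τ𝔄`** for every ideal `𝔄` of `𝓞_L`, `L/K` quadratic Galois with
`Gal(L/K) = {1, τ}` (both sides are multiplicative; primes by
`map_relNorm_eq_mul_smul_of_isMaximal`). [cite: Honda1971, Theorem (relative norm of ideals in the quadratic layer k/L; descent infrastructure)] -/
theorem map_relNorm_eq_mul_smul [IsGalois K L] (h2 : Module.finrank K L = 2)
    {τ : L ≃ₐ[K] L} (hτ : τ ≠ 1) (I : Ideal (𝓞 L)) :
    (Ideal.relNorm (𝓞 K) I).map (algebraMap (𝓞 K) (𝓞 L)) = I * τ • I := by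
  classical
  induction I using UniqueFactorizationMonoid.induction_on_prime with
  | h₁ =>
    rw [Ideal.zero_eq_bot, Ideal.relNorm_bot, Ideal.map_bot, Ideal.bot_mul]
  | h₂ I hI =>
    have hI1 : I = ⊤ := Ideal.isUnit_iff.mp hI
    rw [hI1, Ideal.relNorm_top, Ideal.map_top, Ideal.pointwise_smul_def, Ideal.map_top, Ideal.top_mul]
  | h₃ I P hI hP ih =>
    have hP0 : P ≠ ⊥ := hP.ne_zero
    haveI : P.IsMaximal := (Ideal.isPrime_of_prime hP).isMaximal hP0
    rw [map_mul, Ideal.map_mul, ih, map_relNorm_eq_mul_smul_of_isMaximal h2 hτ P, smul_mul']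
    ring

/-- **The norm class kills `[𝔄 · τ𝔄]`**: `[𝔄 · τ𝔄]^{h_K} = 1` in `Cl(L)` (the class of
`N_{L/K}(𝔄)^{h_K}` is trivial in `Cl(K)`). [cite: Honda1971, Theorem (relative norm of ideals in the quadratic layer k/L; descent infrastructure)] -/
theorem mk0_mul_smul_pow_classNumber [IsGalois K L] (h2 : Module.finrank K L = 2)
    {τ : L ≃ₐ[K] L} (hτ : τ ≠ 1) (I : Ideal (𝓞 L)) (hI : I * τ • I ∈ (Ideal (𝓞 L))⁰) :
    ClassGroup.mk0 ⟨I * τ • I, hI⟩ ^ classNumber K = 1 := by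
  classical
  have hI0 : I ≠ ⊥ := by
    intro h
    have := nonZeroDivisors.ne_zero hI
    rw [h, Ideal.bot_mul] at this
    exact this rfl
  set J := Ideal.relNorm (𝓞 K) I with hJ
  have hJ0 : J ≠ ⊥ := by
    rw [hJ, Ne, Ideal.relNorm_eq_bot_iff]
    exact hI0
  have hJmem : J ∈ (Ideal (𝓞 K))⁰ := mem_nonZeroDivisors_of_ne_zero hJ0
  -- `[J]^{h_K} = 1` in `Cl(K)`, so `J^{h_K} = (g)`
  have hpow_mem : J ^ classNumber K ∈ (Ideal (𝓞 K))⁰ := pow_mem hJmem _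
  have hJpow : ClassGroup.mk0 ⟨J ^ classNumber K, hpow_mem⟩ = 1 := by
    have h : (⟨J ^ classNumber K, hpow_mem⟩ : (Ideal (𝓞 K))⁰) = ⟨J, hJmem⟩ ^ classNumber K :=
      Subtype.ext (by rw [SubmonoidClass.coe_pow])
    rw [h, map_pow, classNumber]
    exact pow_card_eq_one
  obtain ⟨g, hg⟩ := ((ClassGroup.mk0_eq_one_iff hpow_mem).mp hJpow).principal
  -- hence `(I · τI)^{h_K} = (g)𝓞_L`
  have hpow_mem' : (I * τ • I) ^ classNumber K ∈ (Ideal (𝓞 L))⁰ := pow_mem hI _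
  have h' : (⟨I * τ • I, hI⟩ : (Ideal (𝓞 L))⁰) ^ classNumber K =
      ⟨(I * τ • I) ^ classNumber K, hpow_mem'⟩ :=
    Subtype.ext (by rw [SubmonoidClass.coe_pow])
  rw [← map_pow, h', ClassGroup.mk0_eq_one_iff hpow_mem']
  refine ⟨⟨algebraMap (𝓞 K) (𝓞 L) g, ?_⟩⟩
  rw [← map_relNorm_eq_mul_smul h2 hτ I, ← Ideal.map_pow, ← hJ, hg, Ideal.submodule_span_eq,
    Ideal.map_span, Set.image_singleton, Ideal.submodule_span_eq]

end Literature.NumberTheory.NumberFields.Honda1971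

end Part4

/-!
## Part 5 — port of `Summits/QuantumAdvantage/QuantumAdvantage/Theorems/LinnikCubicClassGroupsPureCubicClassNumberHardStubInvariantIdealsPrincipal.lean`

# Invariant ideals are principal (Chevalley's ambiguous-ideal count, cyclic cubic case)

Let `L/F` be a cyclic cubic extension of number fields with group `⟨σ⟩`, `𝓞_F` a PID, and let
`𝔓₁ ≠ 𝔓₂` be maximal ideals of `𝓞_L` with `𝔓ᵢ³ = (tᵢ)`, `tᵢ ∈ 𝓞_F`, such that every prime of
`L` ramified over `F` is `𝔓₁` or `𝔓₂`.  Suppose there are nine norm-one units `ε₀, …, ε₈` of `L`,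
pairwise inequivalent modulo `σ`-coboundaries of units (`εᵢ η ≠ εⱼ σ(η)` for all units `η`,
`i ≠ j`).  Then every nonzero `σ`-invariant ideal of `𝓞_L` is principal.

Proof.  (1) A nonzero `σ`-invariant ideal is `(c) · 𝔓₁^a · 𝔓₂^b` with `c ∈ 𝓞_F`, `a, b < 3`:
peel off, one at a time, either `𝔓ᵢ` (itself invariant since `𝔓ᵢ³ = (tᵢ)`) or, for an
unramified prime `𝔔 ⊇ I` over `𝔮`, the whole of `𝔮𝓞_L = ∏_{𝔔' ∣ 𝔮} 𝔔'` (the Galois group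
`⟨σ⟩` is transitive on the primes over `𝔮` and fixes `I`, so every `𝔔' ∣ 𝔮` divides `I`), which
is principal because `𝓞_F` is a PID; Noetherian induction.  (2) By Hilbert 90 each `εᵢ = σ(yᵢ)/yᵢ`
with `0 ≠ yᵢ ∈ 𝓞_L`, so `(yᵢ)` is invariant, `(yᵢ) = (cᵢ) 𝔓₁^{aᵢ} 𝔓₂^{bᵢ}`.  (3) The map
`i ↦ (aᵢ, bᵢ) ∈ (ℤ/3)²` is injective (a coincidence gives `yᵢ cⱼ = η yⱼ cᵢ` for a unit `η`, and
applying `σ`: `εⱼ η = εᵢ σ(η)`), hence surjective; the values `(1,0)` and `(0,1)` show that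
`𝔓₁` and `𝔓₂` are principal.  (4) Hence so is every `(c) 𝔓₁^a 𝔓₂^b`.
-/

section Part5

open _root_.NumberField _root_.Ideal

open scoped _root_.Pointwise _root_.NumberField

namespace Literature.NumberTheory.NumberFields.Honda1971

open Literature.NumberTheory.GaloisRepresentations

variable {F L : Type*} [Field F] [Field L] [Algebra F L]

/-- An `F`-automorphism of `L` fixes the elements of `𝓞_L` coming from `𝓞_F`. [cite: AouissiMayerIsmailiTalbiAzizi2020, §2.1 (primitive ambiguous ideals I_k^G/I_{k₀} and ambiguous principal ideals P_k^G/P_{k₀}, k₀ a PID)] -/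
theorem smul_algebraMap_ringOfIntegers (σ : L ≃ₐ[F] L) (t : 𝓞 F) :
    σ • algebraMap (𝓞 F) (𝓞 L) t = algebraMap (𝓞 F) (𝓞 L) t :=
  RingOfIntegers.ext (σ.commutes (t : F))

/-- An `F`-automorphism of `L` fixes the principal ideal of `𝓞_L` generated by an element of
`𝓞_F`. [cite: AouissiMayerIsmailiTalbiAzizi2020, §2.1 (primitive ambiguous ideals I_k^G/I_{k₀} and ambiguous principal ideals P_k^G/P_{k₀}, k₀ a PID)] -/
theorem smul_span_algebraMap (σ : L ≃ₐ[F] L) (t : 𝓞 F) :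
    σ • Ideal.span {algebraMap (𝓞 F) (𝓞 L) t} = Ideal.span {algebraMap (𝓞 F) (𝓞 L) t} := by
  rw [Ideal.smul_closure, Set.smul_set_singleton, smul_algebraMap_ringOfIntegers]

/-- A maximal ideal of `𝓞_L` whose cube is generated by an element of `𝓞_F` is invariant under
every `F`-automorphism. [cite: AouissiMayerIsmailiTalbiAzizi2020, §2.1 (primitive ambiguous ideals I_k^G/I_{k₀} and ambiguous principal ideals P_k^G/P_{k₀}, k₀ a PID)] -/
theorem smul_eq_of_pow_three_eq_span (σ : L ≃ₐ[F] L) {P : Ideal (𝓞 L)} (hP : P.IsMaximal)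
    {t : 𝓞 F} (ht : Ideal.span {algebraMap (𝓞 F) (𝓞 L) t} = P ^ 3) : σ • P = P := by
  have h3 : (σ • P) ^ 3 = P ^ 3 := by
    rw [← smul_pow', ← ht, smul_span_algebraMap]
  have hle : P ^ 3 ≤ σ • P := by
    rw [← h3]
    exact Ideal.pow_le_self three_ne_zero
  haveI : (σ • P).IsPrime := hP.isPrime.smul σ
  exact (hP.eq_of_le (IsPrime.ne_top inferInstance) (Ideal.IsPrime.le_of_pow_le hle)).symm

variable [NumberField L]

/-- Peeling an invariant proper factor `M ⊇ I` off a nonzero invariant ideal `I` leaves a strictly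
larger nonzero invariant ideal. [cite: AouissiMayerIsmailiTalbiAzizi2020, §2.1 (primitive ambiguous ideals I_k^G/I_{k₀} and ambiguous principal ideals P_k^G/P_{k₀}, k₀ a PID)] -/
theorem exists_eq_mul_of_le (σ : L ≃ₐ[F] L) {I M : Ideal (𝓞 L)} (hI : I ≠ ⊥) (hM : M ≠ ⊤)
    (hMinv : σ • M = M) (hinv : σ • I = I) (hle : I ≤ M) :
    ∃ J : Ideal (𝓞 L), I = M * J ∧ I < J ∧ J ≠ ⊥ ∧ σ • J = J := by
  obtain ⟨J, rfl⟩ := Ideal.dvd_iff_le.mpr hle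
  have hM0 : M ≠ ⊥ := fun h => hI (by rw [h, Ideal.bot_mul])
  have hJ0 : J ≠ ⊥ := fun h => hI (by rw [h, Ideal.mul_bot])
  refine ⟨J, rfl, ?_, hJ0, ?_⟩
  · refine lt_of_le_of_ne Ideal.mul_le_left (fun h => hM ?_)
    have : M * J = ⊤ * J := by rw [h, Ideal.top_mul]
    exact mul_right_cancel₀ hJ0 this
  · have h := hinv
    rw [smul_mul', hMinv] at h
    exact mul_left_cancel₀ hM0 h

variable [NumberField F]

/-- **One Galois orbit of unramified primes.**  If `I ≠ 0` is invariant under a generator `σ` of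
`Gal(L/F)` and `I ≤ 𝔔` for a prime `𝔔` of `𝓞_L` unramified over `𝔮 = 𝔔 ∩ 𝓞_F`, then
`I ≤ 𝔮𝓞_L = ∏_{𝔔' ∣ 𝔮} 𝔔'` (transitivity of the Galois group on the primes over `𝔮`).
[cite: AouissiMayerIsmailiTalbiAzizi2020, §2.1 (primitive ambiguous ideals I_k^G/I_{k₀} and ambiguous principal ideals P_k^G/P_{k₀}, k₀ a PID)] -/
theorem le_map_under_of_smul_eq [IsGalois F L] (σ : L ≃ₐ[F] L)
    (hσ : ∀ τ : L ≃ₐ[F] L, τ ∈ Subgroup.zpowers σ) {I Q : Ideal (𝓞 L)} (hI : I ≠ ⊥)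
    (hQ : Q.IsMaximal) (he : Q.ramificationIdx (𝓞 F) = 1) (hinv : σ • I = I) (hIQ : I ≤ Q) :
    I ≤ (Q.under (𝓞 F)).map (algebraMap (𝓞 F) (𝓞 L)) := by
  classical
  haveI : (Q.under (𝓞 F)).IsMaximal := Ideal.IsMaximal.under (𝓞 F) Q
  haveI := hQ.isPrime
  have hQ0 : Q ≠ ⊥ := fun h => hI (le_bot_iff.mp (h ▸ hIQ))
  have hq0 : Q.under (𝓞 F) ≠ ⊥ := mt Ideal.eq_bot_of_comap_eq_bot hQ0
  haveI hQq : Q.LiesOver (Q.under (𝓞 F)) := ⟨rfl⟩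
  -- every element of the Galois group fixes `I`
  have hτI : ∀ τ : L ≃ₐ[F] L, τ • I = I := fun τ =>
    MulAction.mem_stabilizer_iff.mp
      ((Subgroup.zpowers_le.mpr (MulAction.mem_stabilizer_iff.mpr hinv)) (hσ τ))
  rw [Ideal.map_algebraMap_eq_finsetProd_pow (R := 𝓞 L) hq0, ← Ideal.dvd_iff_le]
  refine Finset.prod_dvd_of_coprime ?_ ?_
  · intro Q₁ hQ₁ Q₂ hQ₂ hne
    rw [Finset.mem_coe, Set.mem_toFinset] at hQ₁ hQ₂
    haveI h1 : Q₁.IsMaximal := hQ₁.1.isMaximal (ne_bot_of_mem_primesOver hq0 hQ₁)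
    haveI h2 : Q₂.IsMaximal := hQ₂.1.isMaximal (ne_bot_of_mem_primesOver hq0 hQ₂)
    exact (Ideal.isCoprime_of_isMaximal hne).pow
  · intro Q' hQ'
    rw [Set.mem_toFinset] at hQ'
    haveI := hQ'.1
    haveI := hQ'.2
    obtain ⟨τ, rfl⟩ := Ideal.exists_smul_eq_of_isGaloisGroup (Q.under (𝓞 F)) Q Q' (L ≃ₐ[F] L)
    rw [Ideal.ramificationIdx_smul, he, pow_one, Ideal.dvd_iff_le, ← hτI τ]
    exact smul_mono_right τ hIQ

/-- **Structure of invariant ideals.**  With `𝓞_F` a PID, `𝔓ᵢ³ = (tᵢ)` (`tᵢ ∈ 𝓞_F`) and all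
ramification carried by `𝔓₁, 𝔓₂`, a nonzero ideal of `𝓞_L` invariant under a generator `σ` of
`Gal(L/F)` is `(c) · 𝔓₁^a · 𝔓₂^b` with `c ∈ 𝓞_F` and `a, b < 3`. [cite: AouissiMayerIsmailiTalbiAzizi2020, §2.1 (primitive ambiguous ideals I_k^G/I_{k₀} and ambiguous principal ideals P_k^G/P_{k₀}, k₀ a PID)] -/
theorem exists_eq_span_mul_pow [IsGalois F L] (σ : L ≃ₐ[F] L)
    (hσ : ∀ τ : L ≃ₐ[F] L, τ ∈ Subgroup.zpowers σ) (hPID : IsPrincipalIdealRing (𝓞 F))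
    {P₁ P₂ : Ideal (𝓞 L)} (hP₁ : P₁.IsMaximal) (hP₂ : P₂.IsMaximal)
    {t₁ : 𝓞 F} (ht₁ : Ideal.span {algebraMap (𝓞 F) (𝓞 L) t₁} = P₁ ^ 3)
    {t₂ : 𝓞 F} (ht₂ : Ideal.span {algebraMap (𝓞 F) (𝓞 L) t₂} = P₂ ^ 3)
    (hram : ∀ Q : Ideal (𝓞 L), Q.IsMaximal → Q.ramificationIdx (𝓞 F) ≠ 1 → Q = P₁ ∨ Q = P₂)
    (I : Ideal (𝓞 L)) (hI : I ≠ ⊥) (hinv : σ • I = I) :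
    ∃ (c : 𝓞 F) (a b : ℕ), a < 3 ∧ b < 3 ∧
      I = Ideal.span {algebraMap (𝓞 F) (𝓞 L) c} * P₁ ^ a * P₂ ^ b := by
  induction I using IsNoetherian.induction with
  | hgt I ih =>
    by_cases hI1 : I = ⊤
    · refine ⟨1, 0, 0, by norm_num, by norm_num, ?_⟩
      rw [hI1, map_one, Ideal.span_singleton_one, pow_zero, pow_zero, mul_one, mul_one]
    obtain ⟨Q, hQ, hIQ⟩ := Ideal.exists_le_maximal I hI1
    by_cases h1 : Q = P₁
    · rw [h1] at hIQ
      obtain ⟨J, hIJ, hlt, hJ0, hJinv⟩ :=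
        exists_eq_mul_of_le σ hI hP₁.ne_top (smul_eq_of_pow_three_eq_span σ hP₁ ht₁) hinv hIQ
      obtain ⟨c, a, b, ha, hb, hJ⟩ := ih J hlt hJ0 hJinv
      rcases Nat.lt_or_ge (a + 1) 3 with ha' | ha'
      · refine ⟨c, a + 1, b, ha', hb, ?_⟩
        rw [hIJ, hJ]
        ring
      · have ha2 : a = 2 := by omega
        refine ⟨c * t₁, 0, b, by norm_num, hb, ?_⟩
        rw [hIJ, hJ, ha2, map_mul, ← Ideal.span_singleton_mul_span_singleton, ht₁]
        ring
    by_cases h2 : Q = P₂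
    · rw [h2] at hIQ
      obtain ⟨J, hIJ, hlt, hJ0, hJinv⟩ :=
        exists_eq_mul_of_le σ hI hP₂.ne_top (smul_eq_of_pow_three_eq_span σ hP₂ ht₂) hinv hIQ
      obtain ⟨c, a, b, ha, hb, hJ⟩ := ih J hlt hJ0 hJinv
      rcases Nat.lt_or_ge (b + 1) 3 with hb' | hb'
      · refine ⟨c, a, b + 1, ha, hb', ?_⟩
        rw [hIJ, hJ]
        ring
      · have hb2 : b = 2 := by omega
        refine ⟨c * t₂, a, 0, ha, by norm_num, ?_⟩
        rw [hIJ, hJ, hb2, map_mul, ← Ideal.span_singleton_mul_span_singleton, ht₂]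
        ring
    -- `Q` is unramified: peel off the whole orbit `𝔮𝓞_L = (g)`
    have he : Q.ramificationIdx (𝓞 F) = 1 := by
      by_contra hne
      rcases hram Q hQ hne with h | h
      exacts [h1 h, h2 h]
    haveI := hPID
    obtain ⟨g, hg⟩ := (IsPrincipalIdealRing.principal (Q.under (𝓞 F))).principal
    have hM : (Q.under (𝓞 F)).map (algebraMap (𝓞 F) (𝓞 L)) =
        Ideal.span {algebraMap (𝓞 F) (𝓞 L) g} := by
      rw [hg, Ideal.submodule_span_eq, Ideal.map_span, Set.image_singleton]
    have hle : I ≤ Ideal.span {algebraMap (𝓞 F) (𝓞 L) g} :=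
      hM ▸ le_map_under_of_smul_eq σ hσ hI hQ he hinv hIQ
    have hMtop : Ideal.span {algebraMap (𝓞 F) (𝓞 L) g} ≠ ⊤ := by
      rw [← hM]
      exact fun h => hQ.ne_top (top_le_iff.mp (h ▸ Ideal.map_comap_le))
    obtain ⟨J, hIJ, hlt, hJ0, hJinv⟩ :=
      exists_eq_mul_of_le σ hI hMtop (smul_span_algebraMap σ g) hinv hle
    obtain ⟨c, a, b, ha, hb, hJ⟩ := ih J hlt hJ0 hJinv
    refine ⟨g * c, a, b, ha, hb, ?_⟩
    rw [hIJ, hJ, map_mul, ← Ideal.span_singleton_mul_span_singleton]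
    ring

/-- **Hilbert 90, integral form.**  A norm-one element `ε ∈ 𝓞_L` of a cyclic extension `L/F`
with generator `σ` is `σ(y)/y` for some `0 ≠ y ∈ 𝓞_L` (clear denominators with a rational
integer). [cite: AouissiMayerIsmailiTalbiAzizi2020, §2.1 (primitive ambiguous ideals I_k^G/I_{k₀} and ambiguous principal ideals P_k^G/P_{k₀}, k₀ a PID)] -/
theorem exists_smul_eq_mul_of_norm_eq_one [IsGalois F L] (σ : L ≃ₐ[F] L)
    (hσ : ∀ τ : L ≃ₐ[F] L, τ ∈ Subgroup.zpowers σ) {ε : 𝓞 L}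
    (hε : Algebra.norm F ((ε : L)) = 1) : ∃ y : 𝓞 L, y ≠ 0 ∧ σ • y = ε * y := by
  obtain ⟨y, hy0, hy⟩ := CyclicNormIndex.exists_eq_div_of_norm_eq_one hσ hε
  have hx : IsAlgebraic ℤ y := (IsFractionRing.isAlgebraic_iff ℤ ℚ L).mpr (.of_finite ℚ y)
  obtain ⟨m, r, hm, hmr⟩ := hx.exists_nsmul_eq (𝓞 L)
  refine ⟨r, ?_, ?_⟩
  · intro hr
    rw [hr, map_zero, smul_eq_zero] at hmr
    rcases hmr with h | h
    exacts [hm h, hy0 h]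
  · apply RingOfIntegers.ext
    change σ (algebraMap (𝓞 L) L r) = algebraMap (𝓞 L) L (ε * r)
    rw [map_mul, ← hmr, map_nsmul, ← RingOfIntegers.coe_eq_algebraMap, hy, nsmul_eq_mul,
      nsmul_eq_mul]
    field_simp

/-- If `(y) = (c) · P` with `y ≠ 0` in a Dedekind domain, then `P` is principal. [cite: AouissiMayerIsmailiTalbiAzizi2020, §2.1 (primitive ambiguous ideals I_k^G/I_{k₀} and ambiguous principal ideals P_k^G/P_{k₀}, k₀ a PID)] -/
theorem isPrincipal_of_span_singleton_eq_mul {R : Type*} [CommRing R] [IsDedekindDomain R]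
    {y c : R} {P : Ideal R} (h : Ideal.span {y} = Ideal.span {c} * P) (hy : y ≠ 0) :
    Submodule.IsPrincipal P := by
  have hc : c ≠ 0 := by
    rintro rfl
    apply hy
    simpa using h
  have hmem : y ∈ Ideal.span {c} := by
    have : y ∈ Ideal.span {y} := Ideal.mem_span_singleton_self y
    rw [h] at this
    exact Ideal.mul_le_right this
  obtain ⟨z, hz⟩ := Ideal.mem_span_singleton'.mp hmem
  refine ⟨z, ?_⟩
  rw [Ideal.submodule_span_eq]
  refine mul_left_cancel₀ (mt Ideal.span_singleton_eq_bot.mp hc) ?_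
  rw [← h, Ideal.span_singleton_mul_span_singleton, mul_comm c z, hz]

/-- **Invariant ideals are principal** (Chevalley's ambiguous-ideal count for a
cyclic cubic `L/F` over a PID base with two ramified primes and nine inequivalent norm-one
units): every nonzero `σ`-invariant ideal of `𝓞_L` is principal. [cite: AouissiMayerIsmailiTalbiAzizi2020, §2.1 (primitive ambiguous ideals I_k^G/I_{k₀} and ambiguous principal ideals P_k^G/P_{k₀}, k₀ a PID)] -/
theorem invariantIdealsPrincipal :
    ∀ (F L : Type) [Field F] [NumberField F] [Field L] [NumberField L] [Algebra F L]
      [IsGalois F L] (σ : L ≃ₐ[F] L), (∀ τ : L ≃ₐ[F] L, τ ∈ Subgroup.zpowers σ) →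
      Module.finrank F L = 3 → IsPrincipalIdealRing (𝓞 F) →
      ∀ (P₁ P₂ : Ideal (𝓞 L)), P₁.IsMaximal → P₂.IsMaximal → P₁ ≠ P₂ →
        (∃ t₁ : 𝓞 F, Ideal.span {algebraMap (𝓞 F) (𝓞 L) t₁} = P₁ ^ 3) →
        (∃ t₂ : 𝓞 F, Ideal.span {algebraMap (𝓞 F) (𝓞 L) t₂} = P₂ ^ 3) →
        (∀ (Q : Ideal (𝓞 L)), Q.IsMaximal →
          Q.ramificationIdx (𝓞 F) ≠ 1 → Q = P₁ ∨ Q = P₂) →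
        (∃ ε : Fin 9 → (𝓞 L)ˣ,
          (∀ i, Algebra.norm F (((ε i : 𝓞 L) : L)) = 1) ∧
          ∀ i j, i ≠ j → ∀ η : (𝓞 L)ˣ,
            (((ε i : 𝓞 L) : L)) * ((η : 𝓞 L) : L) ≠ (((ε j : 𝓞 L) : L)) * σ ((η : 𝓞 L) : L)) →
        ∀ I : Ideal (𝓞 L), I ≠ ⊥ → σ • I = I → Submodule.IsPrincipal I := by
  intro F L _ _ _ _ _ _ σ hσ _h3 hPID P₁ P₂ hP₁ hP₂ _hP12 ht₁ ht₂ hram hε I hI hinv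
  obtain ⟨t₁, ht₁⟩ := ht₁
  obtain ⟨t₂, ht₂⟩ := ht₂
  obtain ⟨ε, hεN, hεind⟩ := hε
  have hstruct : ∀ J : Ideal (𝓞 L), J ≠ ⊥ → σ • J = J → ∃ (c : 𝓞 F) (a b : ℕ), a < 3 ∧ b < 3 ∧
      J = Ideal.span {algebraMap (𝓞 F) (𝓞 L) c} * P₁ ^ a * P₂ ^ b := fun J hJ hJinv =>
    exists_eq_span_mul_pow σ hσ hPID hP₁ hP₂ ht₁ ht₂ hram J hJ hJinv
  -- it suffices that `P₁` and `P₂` are principal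
  suffices hP : Submodule.IsPrincipal P₁ ∧ Submodule.IsPrincipal P₂ by
    obtain ⟨c, a, b, -, -, hIeq⟩ := hstruct I hI hinv
    obtain ⟨z₁, hz₁⟩ := hP.1.principal
    obtain ⟨z₂, hz₂⟩ := hP.2.principal
    rw [Ideal.submodule_span_eq] at hz₁ hz₂
    rw [hIeq, hz₁, hz₂, Ideal.span_singleton_pow, Ideal.span_singleton_pow,
      Ideal.span_singleton_mul_span_singleton, Ideal.span_singleton_mul_span_singleton]
    infer_instance
  -- Hilbert 90: nine invariant principal ideals `(y i)`
  have hy : ∀ i, ∃ y : 𝓞 L, y ≠ 0 ∧ σ • y = (ε i : 𝓞 L) * y := fun i =>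
    exists_smul_eq_mul_of_norm_eq_one σ hσ (hεN i)
  choose y hy0 hyσ using hy
  have hyinv : ∀ i, σ • Ideal.span {y i} = Ideal.span {y i} := by
    intro i
    rw [Ideal.smul_closure, Set.smul_set_singleton, hyσ]
    exact Ideal.span_singleton_mul_left_unit (ε i).isUnit (y i)
  have hdec : ∀ i, ∃ (c : 𝓞 F) (a b : ℕ), a < 3 ∧ b < 3 ∧
      Ideal.span {y i} = Ideal.span {algebraMap (𝓞 F) (𝓞 L) c} * P₁ ^ a * P₂ ^ b := fun i =>
    hstruct _ (mt Ideal.span_singleton_eq_bot.mp (hy0 i)) (hyinv i)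
  choose c a b ha hb hdec using hdec
  have hc0 : ∀ i, c i ≠ 0 := by
    intro i hci
    apply hy0 i
    have := hdec i
    rw [hci, map_zero] at this
    simpa using this
  -- the exponent pairs are pairwise distinct
  have hinj : Function.Injective (fun i => ((⟨a i, ha i⟩ : Fin 3), (⟨b i, hb i⟩ : Fin 3))) := by
    intro i j hij
    simp only [Prod.mk.injEq, Fin.mk.injEq] at hij
    obtain ⟨haij, hbij⟩ := hij
    by_contra hne
    have key : Ideal.span {y i * algebraMap (𝓞 F) (𝓞 L) (c j)} =
        Ideal.span {y j * algebraMap (𝓞 F) (𝓞 L) (c i)} := by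
      rw [← Ideal.span_singleton_mul_span_singleton, ← Ideal.span_singleton_mul_span_singleton,
        hdec i, hdec j, haij, hbij]
      ring
    obtain ⟨u, hu⟩ := Ideal.span_singleton_eq_span_singleton.mp key
    -- pass to `L` and apply `σ`
    have hu' := congrArg (algebraMap (𝓞 L) L) hu
    rw [map_mul, map_mul, map_mul] at hu'
    have hσu := congrArg (fun x : 𝓞 L => algebraMap (𝓞 L) L (σ • x)) hu
    simp only [smul_mul', map_mul, hyσ, smul_algebraMap_ringOfIntegers] at hσu
    have hσu' : algebraMap (𝓞 L) L (σ • (u : 𝓞 L)) = σ (algebraMap (𝓞 L) L u) := rfl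
    rw [hσu'] at hσu
    have h0 : algebraMap (𝓞 L) L (y i) * algebraMap (𝓞 L) L (algebraMap (𝓞 F) (𝓞 L) (c j)) ≠ 0 :=
      mul_ne_zero (RingOfIntegers.coe_ne_zero_iff.mpr (hy0 i))
        (RingOfIntegers.coe_ne_zero_iff.mpr
          ((map_ne_zero_iff _ (RingOfIntegers.algebraMap.injective F L)).mpr (hc0 j)))
    have hfin : algebraMap (𝓞 L) L (y i) * algebraMap (𝓞 L) L (algebraMap (𝓞 F) (𝓞 L) (c j)) *
        (algebraMap (𝓞 L) L (ε i) * σ (algebraMap (𝓞 L) L u)) =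
        algebraMap (𝓞 L) L (y i) * algebraMap (𝓞 L) L (algebraMap (𝓞 F) (𝓞 L) (c j)) *
        (algebraMap (𝓞 L) L (ε j) * algebraMap (𝓞 L) L u) := by
      linear_combination hσu - algebraMap (𝓞 L) L (ε j) * hu'
    exact hεind j i (Ne.symm hne) u (mul_left_cancel₀ h0 hfin).symm
  -- hence every pair occurs; `(1,0)` and `(0,1)` make `P₁`, `P₂` principal
  have hsurj : Function.Surjective (fun i => ((⟨a i, ha i⟩ : Fin 3), (⟨b i, hb i⟩ : Fin 3))) :=
    ((Fintype.bijective_iff_injective_and_card _).mpr ⟨hinj, by simp⟩).2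
  constructor
  · obtain ⟨i, hi⟩ := hsurj (1, 0)
    simp only [Prod.mk.injEq, Fin.ext_iff, Fin.val_one, Fin.val_zero] at hi
    have h := hdec i
    rw [hi.1, hi.2, pow_one, pow_zero, mul_one] at h
    exact isPrincipal_of_span_singleton_eq_mul h (hy0 i)
  · obtain ⟨i, hi⟩ := hsurj (0, 1)
    simp only [Prod.mk.injEq, Fin.ext_iff, Fin.val_one, Fin.val_zero] at hi
    have h := hdec i
    rw [hi.1, hi.2, pow_one, pow_zero, mul_one] at h
    exact isPrincipal_of_span_singleton_eq_mul h (hy0 i)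

end Literature.NumberTheory.NumberFields.Honda1971

end Part5

/-!
## Part 6 — port of `Summits/QuantumAdvantage/QuantumAdvantage/Theorems/LinnikCubicClassGroupsPureCubicClassNumberHardDescentLemmas.lean`

# Ambiguous classes one at a time: a fixed class of order `3`, its relation, and Chevalley's step

Infrastructure for the Hasse-free DESCENT `3 ∣ h(K(ζ₃)) ⟹ 3 ∣ h(K)`
of Honda's criterion (Part `Descent` below).

* `exists_fixed_class_of_three_dvd_card` — for an automorphism `a` with `a³ = 1` of a Dedekind
  domain `R` with `3 ∣ #Cl(R)`: a class `c ≠ 1`, `c³ = 1`, with `[a • I] = [I]` (the class map is a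
  group endomorphism `f` with `f³ = 1`, `#Fix(f) ≡ #Cl(R) (mod 3)`, Cauchy on the subgroup `Fix(f)`);
* `exists_rel_of_mk0_smul_eq` — the relation `(x) · aI = (y) · I` of a fixed class and the unit
  `u` with `x · ax · a²x · u = y · ay · a²y` (product of the three conjugate relations);
* `mk0_eq_one_of_rel` — **Chevalley's step for ONE class**: in a cyclic cubic `L/F` with all
  `σ`-invariant ideals principal, a class with relation `(x) · σI = (y) · I` and `N(y/x) = N(ε)`
  for a unit `ε` is trivial (Hilbert 90; the per-class form of `mk0_eq_one_of_mk0_smul_eq`).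

## References
* T. Honda, *Pure cubic fields whose class numbers are multiples of three*, J. Number Theory 3
  (1971) 7–12. [Honda1971]
* C. Chevalley, *Sur la théorie du corps de classes dans les corps finis et les corps locaux*,
  J. Fac. Sci. Tokyo 2 (1933) (ambiguous classes). [Chevalley1933]
-/

section Part6

open _root_.NumberField

open scoped _root_.Pointwise _root_.NumberField nonZeroDivisors

namespace Literature.NumberTheory.NumberFields.Honda1971

section ClassMap

variable {M R : Type*} [Group M] [CommRing R] [IsDedekindDomain R] [MulSemiringAction M R]

/-- **A fixed class of order `3`.**  If `a³ = 1` acts on the Dedekind domain `R` and `3` divides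
the class number, some ideal class `c ≠ 1` with `c³ = 1` is fixed by `[I] ↦ [a • I]`: the map is a
group endomorphism `f` with `f³ = 1`, so `#Fix(f) ≡ h (mod 3)` (`Equiv.Perm.card_fixedPoints_modEq`)
and Cauchy's theorem applies to the subgroup `Fix(f)`. [cite: AouissiMayerIsmailiTalbiAzizi2020, proof of Thm. 2.3 (ambiguous classes one at a time; Chevalley's step)] -/
theorem exists_fixed_class_of_three_dvd_card [Fintype (ClassGroup R)] (a : M) (ha : a ^ 3 = 1)
    (h3 : 3 ∣ Fintype.card (ClassGroup R)) :
    ∃ I : (Ideal R)⁰, ClassGroup.mk0 I ≠ 1 ∧ ClassGroup.mk0 I ^ 3 = 1 ∧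
      ClassGroup.mk0 ⟨a • (I : Ideal R), smul_mem_nonZeroDivisors a I⟩ = ClassGroup.mk0 I := by
  classical
  obtain ⟨f, hf⟩ := exists_classMap (R := R) a
  have hf3 : f ^ 3 ^ 1 = 1 := by
    rw [pow_one]
    funext c
    obtain ⟨I, rfl⟩ := ClassGroup.mk0_surjective c
    show f (f (f (ClassGroup.mk0 I))) = ClassGroup.mk0 I
    rw [hf, hf, hf]
    congr 1
    refine Subtype.ext ?_
    show a • a • a • (I : Ideal R) = I
    rw [smul_smul, smul_smul, ← pow_three', ha, one_smul]
  have hfmul : ∀ c d, f (c * d) = f c * f d := by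
    intro c d
    obtain ⟨I, rfl⟩ := ClassGroup.mk0_surjective c
    obtain ⟨J, rfl⟩ := ClassGroup.mk0_surjective d
    rw [← map_mul, hf, hf, hf, ← map_mul]
    congr 1
    refine Subtype.ext ?_
    show a • ((I : Ideal R) * J) = a • (I : Ideal R) * a • (J : Ideal R)
    exact smul_mul' a _ _
  have hf1 : f 1 = 1 := by
    have h := hfmul 1 1
    rw [one_mul] at h
    exact left_eq_mul.mp h
  let fhom : ClassGroup R →* ClassGroup R := { toFun := f, map_one' := hf1, map_mul' := hfmul }
  let H : Subgroup (ClassGroup R) := MonoidHom.eqLocus fhom (MonoidHom.id _)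
  have hmemH : ∀ c, c ∈ H ↔ c ∈ Function.fixedPoints f := fun c => Iff.rfl
  have hcardH : Fintype.card H = Fintype.card (Function.fixedPoints f) :=
    Fintype.card_congr (Equiv.subtypeEquivRight hmemH)
  have hmod := Equiv.Perm.card_fixedPoints_modEq hf3
  have hdvd : 3 ∣ Fintype.card H := by
    rw [hcardH]
    simp only [Nat.ModEq] at hmod
    omega
  obtain ⟨c, hc⟩ := exists_prime_orderOf_dvd_card 3 hdvd
  have hc' : orderOf (c : ClassGroup R) = 3 := by
    rw [Subgroup.orderOf_coe]
    exact hc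
  obtain ⟨I, hI⟩ := ClassGroup.mk0_surjective (c : ClassGroup R)
  refine ⟨I, ?_, ?_, ?_⟩
  · rw [hI]
    intro h1
    rw [h1, orderOf_one] at hc'
    norm_num at hc'
  · rw [hI, ← hc']
    exact pow_orderOf_eq_one _
  · rw [← hf, hI]
    exact c.2

/-- **The relation of a fixed class.**  If `[a • I] = [I]` with `a³ = 1`, then
`(x) · aI = (y) · I` for nonzero `x, y`, and multiplying the three conjugate relations gives a unit
`u` with `x · ax · a²x · u = y · ay · a²y`. [cite: AouissiMayerIsmailiTalbiAzizi2020, proof of Thm. 2.3 (ambiguous classes one at a time; Chevalley's step)] -/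
theorem exists_rel_of_mk0_smul_eq (a : M) (ha : a ^ 3 = 1) (I : (Ideal R)⁰)
    (h : ClassGroup.mk0 ⟨a • (I : Ideal R), smul_mem_nonZeroDivisors a I⟩ = ClassGroup.mk0 I) :
    ∃ x y : R, x ≠ 0 ∧ y ≠ 0 ∧ Ideal.span {x} * a • (I : Ideal R) = Ideal.span {y} * I ∧
      ∃ u : Rˣ, x * a • x * a • a • x * u = y * a • y * a • a • y := by
  classical
  obtain ⟨I, hI0⟩ := I
  have hI : I ≠ ⊥ := nonZeroDivisors.ne_zero hI0
  rw [ClassGroup.mk0_eq_mk0_iff] at h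
  obtain ⟨x, y, hx, hy, hxy⟩ := h
  change Ideal.span {x} * a • I = Ideal.span {y} * I at hxy
  have haI : a • a • a • I = I := by
    rw [smul_smul, smul_smul, ← pow_three', ha, one_smul]
  have h1 : Ideal.span {a • x} * a • a • I = Ideal.span {a • y} * a • I := by
    have := congrArg (a • ·) hxy
    simpa only [smul_mul', pointwise_smul_span_singleton] using this
  have h2 : Ideal.span {a • a • x} * I = Ideal.span {a • a • y} * a • a • I := by
    have := congrArg (a • ·) h1
    simpa only [smul_mul', pointwise_smul_span_singleton, haI] using this
  have hII : I * a • I * a • a • I ≠ 0 :=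
    mul_ne_zero (mul_ne_zero hI (pointwise_smul_ne_bot a hI))
      (pointwise_smul_ne_bot a (pointwise_smul_ne_bot a hI))
  have hNN : Ideal.span {x * a • x * a • a • x} = Ideal.span {y * a • y * a • a • y} := by
    apply mul_right_cancel₀ hII
    calc Ideal.span {x * a • x * a • a • x} * (I * a • I * a • a • I)
        = (Ideal.span {x} * a • I) * (Ideal.span {a • x} * a • a • I) *
            (Ideal.span {a • a • x} * I) := by
          rw [← Ideal.span_singleton_mul_span_singleton, ← Ideal.span_singleton_mul_span_singleton]
          ring
      _ = (Ideal.span {y} * I) * (Ideal.span {a • y} * a • I) *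
            (Ideal.span {a • a • y} * a • a • I) := by rw [hxy, h1, h2]
      _ = Ideal.span {y * a • y * a • a • y} * (I * a • I * a • a • I) := by
          rw [← Ideal.span_singleton_mul_span_singleton, ← Ideal.span_singleton_mul_span_singleton]
          ring
  obtain ⟨u, hu⟩ := Ideal.span_singleton_eq_span_singleton.mp hNN
  exact ⟨x, y, hx, hy, hxy, u, hu⟩

end ClassMap

/-! ### Chevalley's step for one class -/

variable {F L : Type*} [Field F] [NumberField F] [Field L] [NumberField L] [Algebra F L]
  [IsGalois F L] {σ : L ≃ₐ[F] L}

/-- **Chevalley's ambiguous-class step, one class at a time.**  Let `L/F` be cyclic cubic with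
group `⟨σ⟩` and every nonzero `σ`-invariant ideal of `𝓞 L` principal.  If `(x) · σI = (y) · I`
and `N(y/x) = N(ε)` for a unit `ε` of `𝓞 L`, then `[I] = 1`: by Hilbert 90 `y/x = ε σ(w)/w` with
`w ∈ 𝓞 L`, and `(σw)(σ²w) · I` is a `σ`-invariant ideal in the class of `I`.  (The proof of
`mk0_eq_one_of_mk0_smul_eq` with its global hypothesis replaced by the one relation used.)
[cite: AouissiMayerIsmailiTalbiAzizi2020, proof of Thm. 2.3 (ambiguous classes one at a time; Chevalley's step)] -/
theorem mk0_eq_one_of_rel (hσ : ∀ τ : L ≃ₐ[F] L, τ ∈ Subgroup.zpowers σ)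
    (h3 : Module.finrank F L = 3)
    (hP : ∀ I : Ideal (𝓞 L), I ≠ ⊥ → σ • I = I → Submodule.IsPrincipal I)
    (I : (Ideal (𝓞 L))⁰) {x y : 𝓞 L} (hx : x ≠ 0) (hy : y ≠ 0)
    (hxy : Ideal.span {x} * σ • (I : Ideal (𝓞 L)) = Ideal.span {y} * I)
    (ε : (𝓞 L)ˣ) (hε : Algebra.norm F (((ε : 𝓞 L) : L)) = Algebra.norm F ((y : L) / x)) :
    ClassGroup.mk0 I = 1 := by
  classical
  have hσ3 : σ ^ 3 = 1 := pow_three_eq_one_of_finrank_eq_three hσ h3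
  obtain ⟨I, hI0⟩ := I
  have hI : I ≠ ⊥ := nonZeroDivisors.ne_zero hI0
  change Ideal.span {x} * σ • I = Ideal.span {y} * I at hxy
  have hx' : (x : L) ≠ 0 := RingOfIntegers.coe_ne_zero_iff.mpr hx
  have hy' : (y : L) ≠ 0 := RingOfIntegers.coe_ne_zero_iff.mpr hy
  have hε0 : ((ε : 𝓞 L) : L) ≠ 0 := RingOfIntegers.coe_ne_zero_iff.mpr ε.ne_zero
  have hdiv : ∀ a b : L, Algebra.norm F (a / b) = Algebra.norm F a / Algebra.norm F b :=
    fun a b => by rw [div_eq_mul_inv, map_mul, Algebra.norm_inv, div_eq_mul_inv]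
  have hz0 : Algebra.norm F ((y : L) / x) ≠ 0 :=
    Algebra.norm_ne_zero_iff.mpr (div_ne_zero hy' hx')
  have h1' : Algebra.norm F ((y : L) / x / ε) = 1 := by
    rw [hdiv ((y : L) / x), hε, div_self hz0]
  -- Hilbert 90, and an integral representative `w`
  obtain ⟨w₀, hw₀, hw₀'⟩ :=
    Literature.NumberTheory.GaloisRepresentations.CyclicNormIndex.exists_eq_div_of_norm_eq_one
      hσ h1'
  obtain ⟨d, hd, hdint⟩ := exists_integral_multiples ℤ ℚ ({w₀} : Finset L)
  have hdw : IsIntegral ℤ ((d : L) * w₀) := by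
    have := hdint w₀ (Finset.mem_singleton_self w₀)
    rwa [Algebra.smul_def, eq_intCast] at this
  set w : 𝓞 L := ⟨(d : L) * w₀, hdw⟩ with hwdef
  have hw : (w : L) = (d : L) * w₀ := rfl
  have hd' : (d : L) ≠ 0 := Int.cast_ne_zero.mpr hd
  have hwne : (w : L) ≠ 0 := by rw [hw]; exact mul_ne_zero hd' hw₀
  have hwne' : w ≠ 0 := RingOfIntegers.coe_ne_zero_iff.mp hwne
  have hσw : σ (w : L) / w = σ w₀ / w₀ := by
    rw [hw, map_mul, map_intCast, mul_div_mul_left _ _ hd']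
  -- `w · y = x · ε · σw` in `𝓞 L`
  have hrel : (w : L) * y = x * (ε * σ (w : L)) := by
    have h := hw₀'.trans hσw.symm
    rw [div_div, div_eq_div_iff (mul_ne_zero hx' hε0) hwne] at h
    linear_combination h
  have hrelO : w * y = x * ((ε : 𝓞 L) * σ • w) := by
    apply RingOfIntegers.coe_injective
    simp only [map_mul]
    exact hrel
  -- `(w)·σI = (σw)·I`
  have hwI : Ideal.span {w} * σ • I = Ideal.span {σ • w} * I := by
    have hsx : Ideal.span ({x} : Set (𝓞 L)) ≠ 0 := by
      rw [Ne, Ideal.zero_eq_bot, Ideal.span_singleton_eq_bot]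
      exact hx
    apply mul_left_cancel₀ hsx
    calc Ideal.span {x} * (Ideal.span {w} * σ • I)
        = Ideal.span {w} * (Ideal.span {x} * σ • I) := by ring
      _ = Ideal.span {w} * (Ideal.span {y} * I) := by rw [hxy]
      _ = Ideal.span {w * y} * I := by rw [← mul_assoc, Ideal.span_singleton_mul_span_singleton]
      _ = Ideal.span {x * ((ε : 𝓞 L) * σ • w)} * I := by rw [hrelO]
      _ = Ideal.span {x} * (Ideal.span {σ • w} * I) := by
          rw [← Ideal.span_singleton_mul_span_singleton,
            Ideal.span_singleton_mul_left_unit ε.isUnit, mul_assoc]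
  -- the invariant ideal `J = (σw)(σ²w)·I` in the class of `I`
  have hσw3 : σ • σ • σ • w = w := by
    rw [smul_smul, smul_smul, ← pow_three', hσ3, one_smul]
  set J : Ideal (𝓞 L) := Ideal.span {σ • w} * Ideal.span {σ • σ • w} * I with hJ
  have hJσ : σ • J = J := by
    rw [hJ, smul_mul', smul_mul', pointwise_smul_span_singleton, pointwise_smul_span_singleton,
      hσw3, mul_assoc, hwI, ← mul_assoc, mul_comm (Ideal.span {σ • σ • w})]
  have hsw : ∀ t : 𝓞 L, t ≠ 0 → Ideal.span ({t} : Set (𝓞 L)) ≠ ⊥ := fun t ht => by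
    rw [Ne, Ideal.span_singleton_eq_bot]
    exact ht
  have hw1 : σ • w ≠ 0 := (smul_ne_zero_iff_ne σ).mpr hwne'
  have hw2 : σ • σ • w ≠ 0 := (smul_ne_zero_iff_ne σ).mpr hw1
  have hJ0 : J ≠ ⊥ := mul_ne_zero (mul_ne_zero (hsw _ hw1) (hsw _ hw2)) hI
  have hJmem : J ∈ (Ideal (𝓞 L))⁰ := mem_nonZeroDivisors_of_ne_zero hJ0
  have hIJ : ClassGroup.mk0 ⟨I, hI0⟩ = ClassGroup.mk0 ⟨J, hJmem⟩ := by
    rw [ClassGroup.mk0_eq_mk0_iff]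
    refine ⟨σ • w * σ • σ • w, 1, mul_ne_zero hw1 hw2, one_ne_zero, ?_⟩
    show Ideal.span {σ • w * σ • σ • w} * I = Ideal.span {1} * J
    rw [Ideal.span_singleton_one, Ideal.top_mul, hJ, ← Ideal.span_singleton_mul_span_singleton]
  rw [hIJ]
  exact (ClassGroup.mk0_eq_one_iff hJmem).mpr (hP J hJ0 hJσ)

end Literature.NumberTheory.NumberFields.Honda1971

end Part6

/-!
## Part 7 — port of `Summits/QuantumAdvantage/QuantumAdvantage/Theorems/LinnikCubicClassGroupsPureCubicClassNumberHardDescent.lean`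

# Descent `3 ∣ h(K(ζ₃)) ⟹ 3 ∣ h(K)` for a cubic field `K ∋ ∛m`, without Hasse and without Brauer

The descent step of Honda's criterion (Honda 1971, Theorem) for the
case `p ≡ q ≡ 8 (mod 9)` (`…PureCubicClassNumberHardHonda88.lean`).  Classically the descent is
read off the Brauer–Kuroda class number relation `h(K(ζ₃)) = h(K)² q*/3` (Barrucand–Cohn) or
Chevalley's ambiguous class number formula with Hasse's norm theorem; here it is proved from the
non-commutativity `τστ = σ²` of `Gal(K(ζ₃)/ℚ) ≅ S₃`, the ideal norm `N_{L/K}(𝔄)𝓞_L = 𝔄 · τ𝔄`,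
Cauchy's theorem on the `σ`-fixed classes and Hilbert 90, one class at a time:

* `three_dvd_classNumber_descent` — see its docstring for the precise hypotheses (all supplied by
  `fieldSetup_twoPrimes` and `ramificationCensus` for `m = pq`).

## References
* T. Honda, *Pure cubic fields whose class numbers are multiples of three*, J. Number Theory 3
  (1971) 7–12, Theorem. [Honda1971]
* S. Aouissi, D. C. Mayer, M. C. Ismaili, M. Talbi, A. Azizi, *3-rank of ambiguous class groups of
  cubic Kummer extensions*, Period. Math. Hungar. 81 (2020), Thm. 2.3. [AouissiMayerIsmailiTalbiAzizi2020]
* P. Barrucand, H. Cohn, *Remarks on principal factors in a relative cubic field*, J. Number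
  Theory 3 (1971) 226–239.
-/

section Part7

open _root_.NumberField _root_.Polynomial

open scoped _root_.Pointwise _root_.NumberField nonZeroDivisors

namespace Literature.NumberTheory.NumberFields.Honda1971

open Literature.NumberTheory.NumberFields

/-! ### The descent `3 ∣ h(L) ⟹ 3 ∣ h(K)` -/

/-- **Descent of `3`-divisibility from `L = K(ζ₃)` to the cubic field `K`, without the Brauer
class number relation and without Hasse's norm theorem.**  Setting: `K` cubic with `θ ∈ K`,
`θ³ = m ≠ 0`, moved by `σ`; `L/K` quadratic Galois (`L = K(ζ₃)`); `F = ℚ(ζ₃) ⊆ L` with `𝓞_F` a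
PID, units `±ζ^i`, `L/F` cyclic cubic with generator `σ`; the ramified primes of `L/F` are among
`P₁, P₂`, with `Pᵢ³ = (tᵢ)`, `tᵢ ∈ 𝓞_F`, and `Pᵢ = 𝔭ᵢ𝓞_L` for ideals `𝔭ᵢ` of `𝓞_K` with `𝔭ᵢ³`
principal.  Then `3 ∣ h(L) ⟹ 3 ∣ h(K)`.

Proof.  Suppose `3 ∤ h(K)`.  Then `𝔭ᵢ` (order dividing `gcd(3, h_K) = 1`) and hence every
`σ`-invariant ideal `(c)P₁^aP₂^b` of `𝓞_L` is principal.  By Cauchy on the subgroup of `σ`-fixed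
classes (`#Fix ≡ h_L (mod 3)`), some class `c = [I] ≠ 1` with `c³ = 1` is `σ`-fixed:
`(x)·σI = (y)·I`, and `N(x)·u = N(y)` for a unit `u`, necessarily `σ`-fixed, so `u = ±ζ^i` and
`τu = u⁻¹` for the generator `τ` of `Gal(L/K)` (`τστ = σ²`).  The class `τc = [τI]` satisfies
`(στy)·σ(τI) = (στx)·τI` with the SAME unit `u`, so `c·τc = [I·τI]` carries the unit `u²`; but
`I·τI = N_{L/K}(I)𝓞_L` has order dividing `h_K` and `3`, so it is principal, `= (g)`, and comparing
`(xx')·(σg) = (yy')·(g)` gives a unit `η` with `N(η) = u²`, whence `N(η²u³) = u`: the relation of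
`c` has a unit norm, and Hilbert 90 (`mk0_eq_one_of_rel`) gives `c = 1`, a contradiction.
[cite: Honda1971, Theorem (3 ∣ h_k ⟹ 3 ∣ h_L for L = ℚ(∛m), k = L(ζ₃); here Hasse-free)] -/
theorem three_dvd_classNumber_descent
    (K : Type) [Field K] [NumberField K] (hK : Module.finrank ℚ K = 3)
    (L : Type) [Field L] [NumberField L] [Algebra K L] [IsGalois ℚ L] [IsGalois K L]
    (hKL : Module.finrank K L = 2)
    (F : IntermediateField ℚ L) [IsGalois F L] (hFL : Module.finrank F L = 3)
    (hF2 : Module.finrank ℚ F = 2)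
    (σ : L ≃ₐ[F] L) (hσ : ∀ g : L ≃ₐ[F] L, g ∈ Subgroup.zpowers σ)
    (hPID : IsPrincipalIdealRing (𝓞 F))
    (ζ : (𝓞 F)ˣ) (hζeq : (ζ : 𝓞 F) ^ 2 + ζ + 1 = 0)
    (hunits : ∀ w : (𝓞 F)ˣ, ∃ i : ℕ, w = ζ ^ i ∨ w = -ζ ^ i)
    {θ : K} {m : ℕ} (hm : m ≠ 0) (hθ3 : θ ^ 3 = (m : K))
    (hθσ : σ (algebraMap K L θ) ≠ algebraMap K L θ)
    {P₁ P₂ : Ideal (𝓞 L)} (hP₁ : P₁.IsMaximal) (hP₂ : P₂.IsMaximal)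
    {t₁ : 𝓞 F} (ht₁ : Ideal.span {algebraMap (𝓞 F) (𝓞 L) t₁} = P₁ ^ 3)
    {t₂ : 𝓞 F} (ht₂ : Ideal.span {algebraMap (𝓞 F) (𝓞 L) t₂} = P₂ ^ 3)
    (hram : ∀ Q : Ideal (𝓞 L), Q.IsMaximal → Q.ramificationIdx (𝓞 F) ≠ 1 → Q = P₁ ∨ Q = P₂)
    {𝔭₁ : Ideal (𝓞 K)} (h𝔭₁ : 𝔭₁.map (algebraMap (𝓞 K) (𝓞 L)) = P₁)
    (h𝔭₁3 : (𝔭₁ ^ 3).IsPrincipal)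
    {𝔭₂ : Ideal (𝓞 K)} (h𝔭₂ : 𝔭₂.map (algebraMap (𝓞 K) (𝓞 L)) = P₂)
    (h𝔭₂3 : (𝔭₂ ^ 3).IsPrincipal)
    (h3L : 3 ∣ classNumber L) : 3 ∣ classNumber K := by
  classical
  by_contra h3K
  have hcop : Nat.Coprime 3 (classNumber K) :=
    (Nat.Prime.coprime_iff_not_dvd Nat.prime_three).mpr h3K
  have hσ3 : σ ^ 3 = 1 := pow_three_eq_one_of_finrank_eq_three hσ hFL
  -- the generator `τ` of `Gal(L/K)` and `τστ = σ²`
  obtain ⟨τ, hτ⟩ := exists_algEquiv_ne_one_of_finrank_eq_two (K := K) (L := L) hKL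
  have hττ : ∀ w : L, τ (τ w) = w := fun w => by
    rw [← AlgEquiv.mul_apply, mul_self_eq_one_of_finrank_eq_two hKL hτ, AlgEquiv.one_apply]
  have hτσ : ∀ z : L, τ (σ z) = σ (σ (τ z)) :=
    apply_apply_eq_of_generators hK hKL hτ F hF2 hζeq hσ hFL hm hθ3 hθσ
  have hτσσ : ∀ z : L, τ (σ (σ z)) = σ (τ z) := apply_apply_apply_eq F hσ hFL hτσ
  -- on `𝓞 L`
  have hτσO : ∀ z : 𝓞 L, τ • σ • z = σ • σ • τ • z := fun z => RingOfIntegers.ext (hτσ z)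
  have hτσσO : ∀ z : 𝓞 L, τ • σ • σ • z = σ • τ • z := fun z => RingOfIntegers.ext (hτσσ z)
  have hττO : ∀ z : 𝓞 L, τ • τ • z = z := fun z => RingOfIntegers.ext (hττ z)
  have hσσσO : ∀ z : 𝓞 L, σ • σ • σ • z = z := fun z => by
    rw [smul_smul, smul_smul, ← pow_three', hσ3, one_smul]
  -- on ideals
  have hτσI : ∀ J : Ideal (𝓞 L), τ • σ • J = σ • σ • τ • J := by
    intro J
    simp only [Ideal.pointwise_smul_def, Ideal.map_map]
    congr 1
    ext z
    simp only [RingHom.coe_comp, Function.comp_apply, MulSemiringAction.toRingHom_apply, hτσO]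
  have hσσσI : ∀ J : Ideal (𝓞 L), σ • σ • σ • J = J := fun J => by
    rw [smul_smul, smul_smul, ← pow_three', hσ3, one_smul]
  -- the norm form `Nσ z = z · σz · σ²z`
  set Nσ : 𝓞 L → 𝓞 L := fun z => z * σ • z * σ • σ • z with hNσ
  have hNσmul : ∀ a b, Nσ (a * b) = Nσ a * Nσ b := by
    intro a b
    simp only [hNσ, smul_mul']
    ring
  have hNσσ : ∀ z, Nσ (σ • z) = Nσ z := by
    intro z
    simp only [hNσ, hσσσO]
    ring
  have hNστ : ∀ z, Nσ (τ • z) = τ • Nσ z := by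
    intro z
    simp only [hNσ, smul_mul', hτσO, hσσσO]
    ring
  have hNσ0 : ∀ z, z ≠ 0 → Nσ z ≠ 0 := fun z hz =>
    mul_ne_zero (mul_ne_zero hz ((smul_ne_zero_iff_ne σ).mpr hz))
      ((smul_ne_zero_iff_ne σ).mpr ((smul_ne_zero_iff_ne σ).mpr hz))
  have hNσL : ∀ z : 𝓞 L, algebraMap F L (Algebra.norm F (z : L)) = (Nσ z : L) := by
    intro z
    rw [algebraMap_norm_eq_of_finrank_eq_three hσ hFL]
    rfl
  -- (1) every `σ`-invariant ideal is principal
  have hprincK : ∀ {𝔭 : Ideal (𝓞 K)} {P : Ideal (𝓞 L)}, P.IsMaximal →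
      𝔭.map (algebraMap (𝓞 K) (𝓞 L)) = P → (𝔭 ^ 3).IsPrincipal → P.IsPrincipal := by
    intro 𝔭 P hP h𝔭 h𝔭3
    haveI := hP
    have h𝔭0 : 𝔭 ≠ ⊥ := by
      intro h
      rw [h, Ideal.map_bot] at h𝔭
      exact (Ideal.IsMaximal.ne_bot_of_isIntegral_int P) h𝔭.symm
    have hmem : 𝔭 ∈ (Ideal (𝓞 K))⁰ := mem_nonZeroDivisors_of_ne_zero h𝔭0
    have hmem3 : 𝔭 ^ 3 ∈ (Ideal (𝓞 K))⁰ := pow_mem hmem 3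
    have h3 : ClassGroup.mk0 ⟨𝔭, hmem⟩ ^ 3 = 1 := by
      have : (⟨𝔭, hmem⟩ : (Ideal (𝓞 K))⁰) ^ 3 = ⟨𝔭 ^ 3, hmem3⟩ :=
        Subtype.ext (by rw [SubmonoidClass.coe_pow])
      rw [← map_pow, this]
      exact (ClassGroup.mk0_eq_one_iff hmem3).mpr h𝔭3
    have hh : ClassGroup.mk0 ⟨𝔭, hmem⟩ ^ classNumber K = 1 := by
      rw [classNumber]
      exact pow_card_eq_one
    have h1 : ClassGroup.mk0 ⟨𝔭, hmem⟩ = 1 := by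
      have : ClassGroup.mk0 ⟨𝔭, hmem⟩ ^ Nat.gcd 3 (classNumber K) = 1 :=
        pow_gcd_eq_one.mpr ⟨h3, hh⟩
      rwa [Nat.Coprime.gcd_eq_one hcop, pow_one] at this
    obtain ⟨g, hg⟩ := ((ClassGroup.mk0_eq_one_iff hmem).mp h1).principal
    refine ⟨⟨algebraMap (𝓞 K) (𝓞 L) g, ?_⟩⟩
    rw [← h𝔭, hg, Ideal.submodule_span_eq, Ideal.map_span, Set.image_singleton,
      Ideal.submodule_span_eq]
  obtain ⟨g₁, hg₁⟩ := (hprincK hP₁ h𝔭₁ h𝔭₁3).principal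
  obtain ⟨g₂, hg₂⟩ := (hprincK hP₂ h𝔭₂ h𝔭₂3).principal
  rw [Ideal.submodule_span_eq] at hg₁ hg₂
  have hprinc : ∀ J : Ideal (𝓞 L), J ≠ ⊥ → σ • J = J → Submodule.IsPrincipal J := by
    intro J hJ0 hJinv
    obtain ⟨c, a, b, -, -, hJ⟩ :=
      exists_eq_span_mul_pow σ hσ hPID hP₁ hP₂ ht₁ ht₂ hram J hJ0 hJinv
    refine ⟨⟨algebraMap (𝓞 F) (𝓞 L) c * g₁ ^ a * g₂ ^ b, ?_⟩⟩
    rw [hJ, hg₁, hg₂, Ideal.span_singleton_pow, Ideal.span_singleton_pow,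
      Ideal.span_singleton_mul_span_singleton, Ideal.span_singleton_mul_span_singleton,
      Ideal.submodule_span_eq]
  -- (2) a `σ`-fixed class of order `3` and its relation
  have h3card : 3 ∣ Fintype.card (ClassGroup (𝓞 L)) := h3L
  obtain ⟨I, hI1, hI3, hIfix⟩ := exists_fixed_class_of_three_dvd_card σ hσ3 h3card
  obtain ⟨x, y, hx, hy, hxy, u, hu⟩ := exists_rel_of_mk0_smul_eq σ hσ3 I hIfix
  have hI0 : (I : Ideal (𝓞 L)) ≠ ⊥ := nonZeroDivisors.ne_zero I.2
  -- `u` is `σ`-fixed, hence in `F`, hence `±ζ^i`: `u · τu = 1`, `u⁶ = 1`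
  change Nσ x * (u : 𝓞 L) = Nσ y at hu
  have hNσinv : ∀ z, σ • Nσ z = Nσ z := by
    intro z
    simp only [hNσ, smul_mul', hσσσO]
    ring
  have huσ : σ • ((u : 𝓞 L)) = u := by
    have h := congrArg (σ • ·) hu
    simp only [smul_mul', hNσinv] at h
    rw [← hu] at h
    exact mul_left_cancel₀ (hNσ0 x hx) h
  have huσL : σ ((u : 𝓞 L) : L) = ((u : 𝓞 L) : L) := congrArg (fun w : 𝓞 L => (w : L)) huσ
  obtain ⟨f, hf⟩ : ∃ f : F, algebraMap F L f = ((u : 𝓞 L) : L) := by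
    refine (IsGalois.mem_range_algebraMap_iff_fixed (F := F) ((u : 𝓞 L) : L)).mpr fun g => ?_
    rcases algEquiv_eq_of_forall_mem_zpowers F hσ hFL g with rfl | rfl | rfl
    · rfl
    · exact huσL
    · rw [AlgEquiv.mul_apply, huσL, huσL]
  obtain ⟨v, hv⟩ := exists_units_coe_eq_of_algebraMap_eq u hf
  have hvL : ((u : 𝓞 L) : L) = algebraMap F L ((v : 𝓞 F) : F) := by rw [hv, hf]
  obtain ⟨ζL, hζLdef⟩ : ∃ ζL : L, ζL = algebraMap F L ((ζ : 𝓞 F) : F) := ⟨_, rfl⟩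
  have hζL : ζL ^ 2 + ζL + 1 = 0 := by
    have h := congrArg (fun w : 𝓞 F => algebraMap F L (w : F)) hζeq
    rw [hζLdef]
    simpa using h
  have hζL3 : ζL ^ 3 = 1 := by linear_combination (ζL - 1) * hζL
  have hτζ : τ ζL = ζL ^ 2 := by
    have hroot : (τ ζL) ^ 2 + τ ζL + 1 = 0 := by
      have h := congrArg τ hζL
      simpa using h
    rcases Honda1971.eq_or_eq_of_sq_add_self_add_one hζL hroot with h | h
    · exfalso
      obtain ⟨k, hk⟩ := exists_algebraMap_eq_of_fixed hKL hτ h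
      apply sq_add_self_add_one_ne_zero hK k
      apply (algebraMap K L).injective
      rw [map_add, map_add, map_pow, map_one, map_zero, hk, hζL]
    · exact h
  obtain ⟨i, hi⟩ := hunits v
  have huL : ((u : 𝓞 L) : L) = ζL ^ i ∨ ((u : 𝓞 L) : L) = -ζL ^ i := by
    rcases hi with h | h
    · left
      rw [hvL, h, hζLdef]
      simp
    · right
      rw [hvL, h, hζLdef]
      simp
  have huτL : ((u : 𝓞 L) : L) * τ ((u : 𝓞 L) : L) = 1 := by
    rcases huL with h | h
    · rw [h, map_pow, hτζ, ← pow_mul, ← pow_add, show i + 2 * i = 3 * i by ring, pow_mul,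
        hζL3, one_pow]
    · rw [h, map_neg, map_pow, hτζ, neg_mul_neg, ← pow_mul, ← pow_add,
        show i + 2 * i = 3 * i by ring, pow_mul, hζL3, one_pow]
  have hu6L : ((u : 𝓞 L) : L) ^ 6 = 1 := by
    rcases huL with h | h
    · rw [h, ← pow_mul, show i * 6 = 3 * (2 * i) by ring, pow_mul, hζL3, one_pow]
    · rw [h, neg_pow, ← pow_mul, show i * 6 = 3 * (2 * i) by ring, pow_mul, hζL3, one_pow]
      norm_num
  have huτ : (u : 𝓞 L) * τ • (u : 𝓞 L) = 1 := by
    refine RingOfIntegers.ext ?_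
    push_cast
    exact huτL
  have hu6 : (u : 𝓞 L) ^ 6 = 1 := by
    refine RingOfIntegers.ext ?_
    push_cast
    exact hu6L
  have hNσu : Nσ u = (u : 𝓞 L) ^ 3 := by
    simp only [hNσ, huσ]
    ring
  have hNσpow : ∀ (z : 𝓞 L) (n : ℕ), Nσ (z ^ n) = Nσ z ^ n := by
    intro z n
    induction n with
    | zero => simp [hNσ]
    | succ n ih => rw [pow_succ, hNσmul, ih, pow_succ]
  -- (3) the class `τc = [τI]`: relation `(στy)·σ(τI) = (στx)·τI` with the same unit `u`
  have hI'mem : τ • (I : Ideal (𝓞 L)) ∈ (Ideal (𝓞 L))⁰ := smul_mem_nonZeroDivisors τ I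
  have hxy' : Ideal.span {σ • τ • y} * σ • τ • (I : Ideal (𝓞 L)) =
      Ideal.span {σ • τ • x} * τ • (I : Ideal (𝓞 L)) := by
    have h := congrArg (τ • ·) hxy
    simp only [smul_mul', pointwise_smul_span_singleton, hτσI] at h
    have h2 := congrArg (σ • ·) h
    simp only [smul_mul', pointwise_smul_span_singleton, hσσσI] at h2
    exact h2.symm
  have hu' : Nσ (σ • τ • y) * (u : 𝓞 L) = Nσ (σ • τ • x) := by
    rw [hNσσ, hNσσ, hNστ, hNστ, ← hu, smul_mul', mul_assoc, mul_comm (τ • (u : 𝓞 L)), huτ,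
      mul_one]
  -- (4) the product class `[I · τI]` is trivial
  set X : 𝓞 L := x * σ • τ • y with hXdef
  set Y : 𝓞 L := y * σ • τ • x with hYdef
  have hX0 : X ≠ 0 :=
    mul_ne_zero hx ((smul_ne_zero_iff_ne σ).mpr ((smul_ne_zero_iff_ne τ).mpr hy))
  have hĨmem : (I : Ideal (𝓞 L)) * τ • (I : Ideal (𝓞 L)) ∈ (Ideal (𝓞 L))⁰ := mul_mem I.2 hI'mem
  have hXY : Ideal.span {X} * σ • ((I : Ideal (𝓞 L)) * τ • (I : Ideal (𝓞 L))) =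
      Ideal.span {Y} * ((I : Ideal (𝓞 L)) * τ • (I : Ideal (𝓞 L))) := by
    calc Ideal.span {X} * σ • ((I : Ideal (𝓞 L)) * τ • (I : Ideal (𝓞 L)))
        = (Ideal.span {x} * σ • (I : Ideal (𝓞 L))) *
            (Ideal.span {σ • τ • y} * σ • τ • (I : Ideal (𝓞 L))) := by
          rw [hXdef, ← Ideal.span_singleton_mul_span_singleton, smul_mul']
          ring
      _ = (Ideal.span {y} * (I : Ideal (𝓞 L))) *
            (Ideal.span {σ • τ • x} * τ • (I : Ideal (𝓞 L))) := by rw [hxy, hxy']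
      _ = Ideal.span {Y} * ((I : Ideal (𝓞 L)) * τ • (I : Ideal (𝓞 L))) := by
          rw [hYdef, ← Ideal.span_singleton_mul_span_singleton]
          ring
  have hNXY : Nσ X * ((u : 𝓞 L) * u) = Nσ Y := by
    calc Nσ X * ((u : 𝓞 L) * u) = (Nσ x * u) * (Nσ (σ • τ • y) * u) := by
          rw [hXdef, hNσmul]
          ring
      _ = Nσ y * Nσ (σ • τ • x) := by rw [hu, hu']
      _ = Nσ Y := by rw [hYdef, hNσmul]
  -- `[I·τI]^{h_K} = 1` and `[I·τI]^3 = 1`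
  have hh : ClassGroup.mk0 ⟨_, hĨmem⟩ ^ classNumber K = 1 :=
    mk0_mul_smul_pow_classNumber hKL hτ (I : Ideal (𝓞 L)) hĨmem
  have hI3' : ClassGroup.mk0 ⟨τ • (I : Ideal (𝓞 L)), hI'mem⟩ ^ 3 = 1 := by
    have hmem3 : (I : Ideal (𝓞 L)) ^ 3 ∈ (Ideal (𝓞 L))⁰ := pow_mem I.2 3
    have h3 : ClassGroup.mk0 ⟨(I : Ideal (𝓞 L)) ^ 3, hmem3⟩ = 1 := by
      have : (⟨(I : Ideal (𝓞 L)) ^ 3, hmem3⟩ : (Ideal (𝓞 L))⁰) = I ^ 3 :=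
        Subtype.ext (by rw [SubmonoidClass.coe_pow])
      rw [this, map_pow, hI3]
    obtain ⟨g₃, hg₃⟩ := ((ClassGroup.mk0_eq_one_iff hmem3).mp h3).principal
    rw [Ideal.submodule_span_eq] at hg₃
    have hmem3' : (τ • (I : Ideal (𝓞 L))) ^ 3 ∈ (Ideal (𝓞 L))⁰ := pow_mem hI'mem 3
    have : (⟨τ • (I : Ideal (𝓞 L)), hI'mem⟩ : (Ideal (𝓞 L))⁰) ^ 3 = ⟨_, hmem3'⟩ :=
      Subtype.ext (by rw [SubmonoidClass.coe_pow])
    rw [← map_pow, this, ClassGroup.mk0_eq_one_iff hmem3']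
    refine ⟨⟨τ • g₃, ?_⟩⟩
    rw [← smul_pow', hg₃, pointwise_smul_span_singleton, Ideal.submodule_span_eq]
  have hĨ3 : ClassGroup.mk0 ⟨_, hĨmem⟩ ^ 3 = 1 := by
    have : (⟨_, hĨmem⟩ : (Ideal (𝓞 L))⁰) = I * ⟨τ • (I : Ideal (𝓞 L)), hI'mem⟩ :=
      Subtype.ext rfl
    rw [this, map_mul, mul_pow, hI3, hI3', one_mul]
  have hĨ1 : ClassGroup.mk0 ⟨_, hĨmem⟩ = 1 := by
    have : ClassGroup.mk0 ⟨_, hĨmem⟩ ^ Nat.gcd 3 (classNumber K) = 1 :=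
      pow_gcd_eq_one.mpr ⟨hĨ3, hh⟩
    rwa [Nat.Coprime.gcd_eq_one hcop, pow_one] at this
  obtain ⟨g, hg⟩ := ((ClassGroup.mk0_eq_one_iff hĨmem).mp hĨ1).principal
  rw [Ideal.submodule_span_eq] at hg
  have hg0 : g ≠ 0 := by
    intro h0
    rw [h0, Ideal.span_singleton_eq_bot.mpr rfl] at hg
    exact (nonZeroDivisors.ne_zero hĨmem) hg
  -- comparing generators: `X · σg · η = Y · g`
  rw [hg, pointwise_smul_span_singleton, Ideal.span_singleton_mul_span_singleton,
    Ideal.span_singleton_mul_span_singleton] at hXY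
  obtain ⟨η, hη⟩ := Ideal.span_singleton_eq_span_singleton.mp hXY
  -- norms: `N(η) = u²`
  have hNη : Nσ (η : 𝓞 L) = (u : 𝓞 L) * u := by
    have h := congrArg Nσ hη
    simp only [hNσmul, hNσσ] at h
    rw [← hNXY] at h
    have h' : Nσ X * Nσ g * Nσ (η : 𝓞 L) = Nσ X * Nσ g * ((u : 𝓞 L) * u) := by
      linear_combination h
    exact mul_left_cancel₀ (mul_ne_zero (hNσ0 X hX0) (hNσ0 g hg0)) h'
  -- the unit `ε = η² u³` has `N(ε) = u = N(y/x)`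
  set ε : (𝓞 L)ˣ := η ^ 2 * u ^ 3 with hεdef
  have hNε : Nσ (ε : 𝓞 L) = u := by
    have hεval : ((ε : (𝓞 L)ˣ) : 𝓞 L) = (η : 𝓞 L) ^ 2 * (u : 𝓞 L) ^ 3 := by
      rw [hεdef, Units.val_mul, Units.val_pow_eq_pow_val, Units.val_pow_eq_pow_val]
    rw [hεval, hNσmul, hNσpow, hNσpow, hNη, hNσu]
    linear_combination ((u : 𝓞 L) ^ 7 + u) * hu6
  have hε : Algebra.norm F (((ε : 𝓞 L) : L)) = Algebra.norm F ((y : L) / x) := by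
    apply (algebraMap F L).injective
    have hdiv : Algebra.norm F ((y : L) / x) = Algebra.norm F (y : L) / Algebra.norm F (x : L) := by
      rw [div_eq_mul_inv, map_mul, Algebra.norm_inv, div_eq_mul_inv]
    have hNx0L : ((Nσ x : 𝓞 L) : L) ≠ 0 := RingOfIntegers.coe_ne_zero_iff.mpr (hNσ0 x hx)
    rw [hNσL, hNε, hdiv, map_div₀, hNσL, hNσL, eq_div_iff hNx0L, ← hu]
    push_cast
    ring
  exact hI1 (mk0_eq_one_of_rel hσ hFL hprinc I hx hy hxy ε hε)

end Literature.NumberTheory.NumberFields.Honda1971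

end Part7

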